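import Literature.NumberTheory.Sieve.ChenSwitchedSieve
import Mathlib.Analysis.SumIntegralComparisons
import Mathlib.Analysis.SpecialFunctions.Log.Monotone
import HarnessLib

/-!
# Chen's theorem: the cardinality of the enlarged switched set (Nathanson, Thm 10.6, p. 290) — PROVED

Topic `Literature/NumberTheory/Sieve`; sequel of `ChenSwitchedSieve.lean` (the sieve step of
Nathanson, *Additive Number Theory: The Classical Bases*, GTM 164, Thm 10.6, for
`B = {N − p₁p₂p₃}`). This file proves the third of the three steps of the proof of Theorem 10.6,
the count of the enlarged index set `T̃(N, ε)` (`switchedTriplesExt`):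

  `#T̃(N, ε) ≤ (1 + ε)² (c + η) N/log N`  for all large `N`, every `0 < ε ≤ 1`, `η > 0`
  (`card_switchedTriplesExt_le`), `c = ∫_{1/8}^{1/3} log(2 − 3β)/(β(1 − β)) dβ = switchingConstant`,

Nathanson's "`|B̃| < (1 + O(ε)) cN/log N + O(N/(log N)²)`" (pp. 289–290 of the book).

## The argument (Nathanson pp. 289–290) and its formal counterpart

* `T̃ ⊆ {z ≤ p₁ < y ≤ p₂ ≤ p₃, p₁p₂p₃ < (1+ε)N}`, so
  `#T̃ ≤ ∑_{p₁} ∑_{p₂ : p₁p₂² < (1+ε)N} π((1+ε)N/(p₁p₂))` (`card_switchedTriplesExt_le_sum`);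
* the prime number theorem `π(x) < (1+κ)x/log x` (`exists_card_primesBelow_ceil_le`, from the tree's
  PNT `Chen.eventually_primeCounting_bounds`) gives, with `X' = (1+ε)N`, `L' = log X'`,
  `u_i = log p_i/L'`, the bound `(1+κ)(X'/L') ∑_{p₁} p₁⁻¹ ∑_{p₂} p₂⁻¹/(1 − u₁ − u₂)`
  (`card_le_pnt_sum`);
* the sums over primes against `1/p` are compared with integrals in the logarithmic variable through
  MERTENS' second theorem with rate on the windows of a grid `X'^{t_j}` (`sum_primeWindow_grid_le`;
  the book integrates by parts against `S(t) = ∑_{p<t} 1/p = log log t + B + O(1/log t)`): the inner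
  sum is at most `Φ(u₁) + O(1/m) + O(m/L')` where
  `Φ(u) = ∫_{1/3}^{(1−u)/2} dv/(v(1−u−v)) = log(2 − 3u)/(1 − u)` (`phiFun`, `phiFun_eq_integral` by
  the fundamental theorem of calculus, `inner_sum_le`, `inner_applied`; the kernel `1/(v(c − v))` is
  antitone on `(0, c/2]`, so right Riemann sums are below the integral), and the outer sum is at most
  `∫_{1/8}^{1/3} Φ(s)/s ds + O(1/m) + O(m/L') = c + …` (`outer_sum_le`, `outer_applied`: `Φ` and
  `Φ(s)/s` are antitone on `(0, 1/3]`, `integral_phiFun_div`).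

Everything is proved; the definitions (`phiFun`, `primeWindow`, `firstPrimes`, `secondPrimes`) are
concrete.

## References

* M. B. Nathanson, *Additive Number Theory: The Classical Bases*, GTM 164 (1996), Thm 10.6 (proof),
  pp. 289–290. [Nathanson1996]
* G. H. Hardy, E. M. Wright, *An Introduction to the Theory of Numbers*, Thm 427 (Mertens' second
  theorem; the tree's `abs_primeRecipSum_sub_le`). [HardyWright2008]
-/

open Finset Filter Topology

noncomputable section

namespace Literature.NumberTheory.Sieve.Chen

open Literature.NumberTheory.LFunctions.Mertens

/-! ### The function `Φ(u) = log(2 − 3u)/(1 − u)` and the kernel `1/(v(c − v))` -/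

/-- Nathanson's inner integral in closed form:
`Φ(u) = ∫_{1/3}^{(1−u)/2} dv/(v(1−u−v)) = log(2 − 3u)/(1 − u)` (p. 290: the inner integral of
`∫∫ dα dβ/(αβ(1−α−β))`). [cite: Nathanson1996, Thm 10.6 (proof, p. 290)] -/
def phiFun (u : ℝ) : ℝ := Real.log (2 - 3 * u) / (1 - u)

/-- `Φ(u) ≥ 0` for `u ≤ 1/3`. [folklore] -/
theorem phiFun_nonneg {u : ℝ} (hu : u ≤ 1 / 3) : 0 ≤ phiFun u :=
  div_nonneg (Real.log_nonneg (by linarith)) (by linarith)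

/-- `Φ(u) ≤ 2` for `0 ≤ u ≤ 1/3` (`log(2 − 3u) ≤ log 2 < 1`, `1 − u ≥ 2/3`). [folklore] -/
theorem phiFun_le_two {u : ℝ} (hu0 : 0 ≤ u) (hu : u ≤ 1 / 3) : phiFun u ≤ 2 := by
  unfold phiFun
  rw [div_le_iff₀ (by linarith)]
  have h1 : Real.log (2 - 3 * u) ≤ Real.log 2 := Real.log_le_log (by linarith) (by linarith)
  have h2 := Real.log_two_lt_d9
  linarith

/-- **`Φ` is antitone on `[0, 1/3]`**: with `s = 2 − 3u ∈ [1, 2]`, `Φ(u) = 3 log s/(1 + s)`, and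
`s ↦ log s/(1+s)` is increasing on `[1, 2]` (for `1 ≤ s < t ≤ 2`:
`(1+s)(log t − log s) ≥ (1+s)(t−s)/t ≥ (t−s)(s−1) ≥ (t−s) log s`). [folklore] -/
theorem phiFun_antitoneOn : AntitoneOn phiFun (Set.Icc 0 (1 / 3)) := by
  intro u hu u' hu' huu'
  obtain ⟨hu0, hu1⟩ := hu
  obtain ⟨hu0', hu1'⟩ := hu'
  -- `s = 2 - 3u' ≤ t = 2 - 3u`
  set s := 2 - 3 * u' with hs
  set t := 2 - 3 * u with ht
  have hs1 : 1 ≤ s := by linarith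
  have hst : s ≤ t := by linarith
  have ht2 : t ≤ 2 := by linarith
  have hs0 : 0 < s := by linarith
  have ht0 : 0 < t := by linarith
  -- `Φ(u) = 3 log t/(1+t)`, `Φ(u') = 3 log s/(1+s)`
  have e1 : phiFun u = 3 * Real.log t / (1 + t) := by
    unfold phiFun
    have h1 : (1 : ℝ) - u ≠ 0 := by linarith
    have h2 : (1 : ℝ) + t ≠ 0 := by linarith
    rw [div_eq_div_iff h1 h2, ht]; ring
  have e2 : phiFun u' = 3 * Real.log s / (1 + s) := by
    unfold phiFun
    have h1 : (1 : ℝ) - u' ≠ 0 := by linarith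
    have h2 : (1 : ℝ) + s ≠ 0 := by linarith
    rw [div_eq_div_iff h1 h2, hs]; ring
  rw [e1, e2, div_le_div_iff₀ (by linarith) (by linarith)]
  -- `log s (1+t) ≤ log t (1+s)`
  have hlogs : 0 ≤ Real.log s := Real.log_nonneg hs1
  have hlogst : Real.log t - Real.log s ≥ (t - s) / t := by
    have h := Real.log_le_sub_one_of_pos (div_pos hs0 ht0)
    rw [Real.log_div hs0.ne' ht0.ne'] at h
    have : s / t - 1 = -((t - s) / t) := by field_simp; ring
    linarith
  have hlogs1 : Real.log s ≤ s - 1 := Real.log_le_sub_one_of_pos hs0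
  -- `(1+s)(log t - log s) ≥ (1+s)(t-s)/t ≥ (t-s)(s-1) ≥ (t-s) log s`
  have key : (t - s) * Real.log s ≤ (1 + s) * (Real.log t - Real.log s) := by
    have h1 : (t - s) * Real.log s ≤ (t - s) * (s - 1) :=
      mul_le_mul_of_nonneg_left hlogs1 (by linarith)
    have h2 : (t - s) * (s - 1) ≤ (1 + s) * ((t - s) / t) := by
      rw [mul_div_assoc', le_div_iff₀ ht0]
      have hA : (s - 1) * t ≤ 1 + s := by
        nlinarith [mul_le_mul_of_nonneg_left ht2 (by linarith : (0 : ℝ) ≤ s - 1)]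
      calc (t - s) * (s - 1) * t = (t - s) * ((s - 1) * t) := by ring
        _ ≤ (t - s) * (1 + s) := mul_le_mul_of_nonneg_left hA (by linarith)
        _ = (1 + s) * (t - s) := by ring
    have h3 : (1 + s) * ((t - s) / t) ≤ (1 + s) * (Real.log t - Real.log s) :=
      mul_le_mul_of_nonneg_left hlogst (by linarith)
    linarith
  nlinarith

/-- The antiderivative of `1/(v(c − v))`: `d/dv [(log v − log(c − v))/c] = 1/(v(c − v))` for
`0 < v < c`. [folklore] -/
theorem hasDerivAt_log_sub_log_div {c v : ℝ} (hv : 0 < v) (hvc : v < c) :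
    HasDerivAt (fun w => (Real.log w - Real.log (c - w)) / c) (1 / (v * (c - v))) v := by
  have hc : 0 < c := hv.trans hvc
  have h1 : HasDerivAt Real.log v⁻¹ v := Real.hasDerivAt_log hv.ne'
  have h2 : HasDerivAt (fun w => Real.log (c - w)) ((-1) / (c - v)) v := by
    have h := ((hasDerivAt_id v).const_sub c).log (by simp only [id]; linarith)
    simpa only [id] using h
  have h3 : HasDerivAt (fun w => (Real.log w - Real.log (c - w)) / c)
      ((v⁻¹ - (-1) / (c - v)) / c) v := (h1.sub h2).div_const c
  refine h3.congr_deriv ?_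
  have hcv : c - v ≠ 0 := by linarith
  have hv0 : v ≠ 0 := hv.ne'
  field_simp
  ring

/-- **The inner integral**: for `0 < α ≤ β < c`,
`∫_α^β dv/(v(c − v)) = [(log β − log(c−β)) − (log α − log(c−α))]/c`. [folklore] -/
theorem integral_inv_mul_sub {c α β : ℝ} (hα : 0 < α) (hαβ : α ≤ β) (hβ : β < c) :
    ∫ v in α..β, 1 / (v * (c - v)) =
      ((Real.log β - Real.log (c - β)) - (Real.log α - Real.log (c - α))) / c := by
  have hderiv : ∀ v ∈ Set.uIcc α β,
      HasDerivAt (fun w => (Real.log w - Real.log (c - w)) / c) (1 / (v * (c - v))) v := by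
    intro v hv
    rw [Set.uIcc_of_le hαβ] at hv
    exact hasDerivAt_log_sub_log_div (by linarith [hv.1]) (by linarith [hv.2])
  have hcont : ContinuousOn (fun v : ℝ => 1 / (v * (c - v))) (Set.uIcc α β) := by
    rw [Set.uIcc_of_le hαβ]
    refine continuousOn_const.div (continuousOn_id.mul (continuousOn_const.sub continuousOn_id)) ?_
    intro v hv
    have : 0 < v := by linarith [hv.1]
    have : 0 < c - v := by linarith [hv.2]
    positivity
  rw [intervalIntegral.integral_eq_sub_of_hasDerivAt hderiv (hcont.intervalIntegrable)]
  ring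

/-- `Φ(u) = ∫_{1/3}^{(1−u)/2} dv/(v(1−u−v))` for `u ≤ 1/3`. [cite: Nathanson1996, Thm 10.6 (proof, p. 290)] -/
theorem phiFun_eq_integral {u : ℝ} (hu : u ≤ 1 / 3) :
    phiFun u = ∫ v in (1 / 3 : ℝ)..((1 - u) / 2), 1 / (v * ((1 - u) - v)) := by
  rw [integral_inv_mul_sub (by norm_num) (by linarith) (by linarith)]
  unfold phiFun
  have h1 : (1 - u) - (1 - u) / 2 = (1 - u) / 2 := by ring
  have h2 : (1 - u) - 1 / 3 = (2 - 3 * u) / 3 := by ring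
  rw [h1, h2, sub_self]
  have e3 : Real.log ((2 - 3 * u) / 3) = Real.log (2 - 3 * u) - Real.log 3 :=
    Real.log_div (ne_of_gt (by linarith)) (by norm_num)
  have e4 : Real.log ((1 : ℝ) / 3) = -Real.log 3 := by rw [one_div, Real.log_inv]
  rw [e3, e4]
  have h1u : (1 : ℝ) - u ≠ 0 := by linarith
  field_simp
  ring

/-- The kernel `v ↦ 1/(v(c − v))` is antitone on `(0, c/2]` (the parabola `v(c − v)` increases
there). [folklore] -/
theorem inv_mul_sub_antitoneOn (c : ℝ) :
    AntitoneOn (fun v : ℝ => 1 / (v * (c - v))) (Set.Ioc 0 (c / 2)) := by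
  intro v hv w hw hvw
  have hv0 : 0 < v := hv.1
  have hw2 : w ≤ c / 2 := hw.2
  have hprod : v * (c - v) ≤ w * (c - w) := by nlinarith
  have hpos : 0 < v * (c - v) := by nlinarith [hv.2]
  exact one_div_le_one_div_of_le hpos hprod

/-! ### Riemann sums of antitone functions with step `Δ` -/

/-- **Right-endpoint Riemann sums of an antitone function are below the integral**:
for `Δ > 0` and `f` antitone on `[t₀, t₀ + mΔ]`,
`∑_{i<m} Δ f(t₀ + (i+1)Δ) ≤ ∫_{t₀}^{t₀+mΔ} f`. [folklore] -/
theorem sum_mul_le_integral_of_antitoneOn {f : ℝ → ℝ} {t₀ Δ : ℝ} (hΔ : 0 < Δ) (m : ℕ)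
    (hf : AntitoneOn f (Set.Icc t₀ (t₀ + m * Δ))) :
    ∑ i ∈ Finset.range m, Δ * f (t₀ + (i + 1) * Δ) ≤ ∫ s in t₀..(t₀ + m * Δ), f s := by
  -- rescale to unit steps
  set g : ℝ → ℝ := fun w => f (Δ * w + t₀) with hg
  have hga : AntitoneOn g (Set.Icc 0 (0 + m)) := by
    intro w hw w' hw' hww'
    simp only [hg]
    refine hf ⟨by nlinarith [hw.1], by nlinarith [hw.2]⟩ ⟨by nlinarith [hw'.1], by nlinarith [hw'.2]⟩ ?_
    nlinarith
  have h := AntitoneOn.sum_le_integral hga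
  simp only [zero_add] at h
  have hint : ∫ w in (0 : ℝ)..m, g w = Δ⁻¹ * ∫ s in t₀..(t₀ + m * Δ), f s := by
    simp only [hg]
    rw [intervalIntegral.integral_comp_mul_add _ hΔ.ne', smul_eq_mul,
      show Δ * (m : ℝ) + t₀ = t₀ + m * Δ by ring, show Δ * (0 : ℝ) + t₀ = t₀ by ring]
  rw [hint] at h
  have h2 : ∑ i ∈ Finset.range m, Δ * f (t₀ + (i + 1) * Δ) = Δ * ∑ i ∈ Finset.range m, g ((i + 1 : ℕ) : ℝ) := by
    rw [Finset.mul_sum]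
    refine Finset.sum_congr rfl fun i _ => ?_
    simp only [hg]
    push_cast
    ring_nf
  rw [h2]
  calc Δ * ∑ i ∈ Finset.range m, g ((i + 1 : ℕ) : ℝ) ≤ Δ * (Δ⁻¹ * ∫ s in t₀..(t₀ + m * Δ), f s) :=
        mul_le_mul_of_nonneg_left h hΔ.le
    _ = ∫ s in t₀..(t₀ + m * Δ), f s := by field_simp

/-! ### Mertens windows: `∑_{x₁ < p ≤ x₂} 1/p ≤ log(log x₂/log x₁) + 16/log x₁` -/

/-- The primes in the window `(x₁, x₂]`. [folklore] -/
def primeWindow (x₁ x₂ : ℝ) : Finset ℕ := Nat.primesLE ⌊x₂⌋₊ \ Nat.primesLE ⌊x₁⌋₊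

/-- Membership in a window: `p` prime with `x₁ < p ≤ x₂` (for `x₁ ≥ 0`). [folklore] -/
theorem mem_primeWindow {x₁ x₂ : ℝ} (hx₁ : 0 ≤ x₁) {p : ℕ} :
    p ∈ primeWindow x₁ x₂ ↔ p.Prime ∧ x₁ < p ∧ (p : ℝ) ≤ x₂ := by
  rw [primeWindow, Finset.mem_sdiff, Nat.mem_primesLE, Nat.mem_primesLE]
  constructor
  · rintro ⟨⟨hp2, hp⟩, hn⟩
    refine ⟨hp, ?_, ?_⟩
    · by_contra h
      exact hn ⟨Nat.le_floor (le_of_not_gt h), hp⟩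
    · have hx₂ : 0 ≤ x₂ := by
        by_contra h
        rw [Nat.floor_of_nonpos (not_le.mp h).le] at hp2
        exact absurd hp2 (by have := hp.two_le; omega)
      exact (Nat.le_floor_iff hx₂).mp hp2
  · rintro ⟨hp, h1, h2⟩
    refine ⟨⟨Nat.le_floor h2, hp⟩, fun ⟨h, _⟩ => ?_⟩
    have : (p : ℝ) ≤ x₁ := (Nat.le_floor_iff hx₁).mp h
    linarith

/-- **Mertens' second theorem on a window** (from the tree's `abs_primeRecipSum_sub_le`, Hardy–Wright
Thm 427 with rate): for `2 ≤ x₁ ≤ x₂`,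
`∑_{x₁ < p ≤ x₂} 1/p ≤ log(log x₂/log x₁) + 16/log x₁`. [cite: HardyWright2008, Thm 427] -/
theorem sum_inv_primeWindow_le {x₁ x₂ : ℝ} (hx₁ : 2 ≤ x₁) (hx₁₂ : x₁ ≤ x₂) :
    ∑ p ∈ primeWindow x₁ x₂, (p : ℝ)⁻¹ ≤
      Real.log (Real.log x₂ / Real.log x₁) + 16 / Real.log x₁ := by
  have hsub : Nat.primesLE ⌊x₁⌋₊ ⊆ Nat.primesLE ⌊x₂⌋₊ := by
    intro p hp
    rw [Nat.mem_primesLE] at hp ⊢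
    exact ⟨hp.1.trans (Nat.floor_le_floor hx₁₂), hp.2⟩
  have heq : ∑ p ∈ primeWindow x₁ x₂, (p : ℝ)⁻¹ = primeRecipSum x₂ - primeRecipSum x₁ := by
    rw [primeRecipSum, primeRecipSum, primeWindow, Finset.sum_sdiff_eq_sub hsub]
  rw [heq]
  have h1 := abs_primeRecipSum_sub_le (hx₁.trans hx₁₂)
  have h2 := abs_primeRecipSum_sub_le hx₁
  rw [abs_le] at h1 h2
  have hlog1 : 0 < Real.log x₁ := Real.log_pos (by linarith)
  have hlog2 : 0 < Real.log x₂ := Real.log_pos (by linarith)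
  have h16 : 8 / Real.log x₂ ≤ 8 / Real.log x₁ :=
    div_le_div_of_nonneg_left (by norm_num) hlog1 (Real.log_le_log (by linarith) hx₁₂)
  rw [Real.log_div hlog2.ne' hlog1.ne']
  have e16 : (16 : ℝ) / Real.log x₁ = 8 / Real.log x₁ + 8 / Real.log x₁ := by ring
  linarith [h1.2, h2.1]

/-- Weighted form: if `0 ≤ g(p) ≤ G` on the window, then
`∑_{x₁ < p ≤ x₂} g(p)/p ≤ G (log(log x₂/log x₁) + 16/log x₁)`. [folklore] -/
theorem sum_mul_inv_primeWindow_le {x₁ x₂ : ℝ} (hx₁ : 2 ≤ x₁) (hx₁₂ : x₁ ≤ x₂) {g : ℕ → ℝ} {G : ℝ}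
    (hg : ∀ p ∈ primeWindow x₁ x₂, g p ≤ G) (hG : 0 ≤ G) :
    ∑ p ∈ primeWindow x₁ x₂, g p * (p : ℝ)⁻¹ ≤
      G * (Real.log (Real.log x₂ / Real.log x₁) + 16 / Real.log x₁) := by
  have hwin : 0 ≤ Real.log (Real.log x₂ / Real.log x₁) + 16 / Real.log x₁ := by
    have hlog1 : 0 < Real.log x₁ := Real.log_pos (by linarith)
    have : 1 ≤ Real.log x₂ / Real.log x₁ := by
      rw [le_div_iff₀ hlog1, one_mul]; exact Real.log_le_log (by linarith) hx₁₂
    have := Real.log_nonneg this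
    positivity
  calc ∑ p ∈ primeWindow x₁ x₂, g p * (p : ℝ)⁻¹ ≤ ∑ p ∈ primeWindow x₁ x₂, G * (p : ℝ)⁻¹ :=
        Finset.sum_le_sum fun p hp => mul_le_mul_of_nonneg_right (hg p hp) (by positivity)
    _ = G * ∑ p ∈ primeWindow x₁ x₂, (p : ℝ)⁻¹ := by rw [Finset.mul_sum]
    _ ≤ _ := mul_le_mul_of_nonneg_left (sum_inv_primeWindow_le hx₁ hx₁₂) hG

/-- Splitting a window along intermediate points: for a monotone sequence `x₀ ≤ x₁ ≤ … ≤ x_m`,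
`∑_{x₀ < p ≤ x_m} w(p) = ∑_{j<m} ∑_{x_j < p ≤ x_{j+1}} w(p)`. [folklore] -/
theorem sum_primeWindow_eq_sum_range (x : ℕ → ℝ) (hx : Monotone x) (w : ℕ → ℝ) (m : ℕ) :
    ∑ p ∈ primeWindow (x 0) (x m), w p =
      ∑ j ∈ Finset.range m, ∑ p ∈ primeWindow (x j) (x (j + 1)), w p := by
  induction m with
  | zero => simp [primeWindow]
  | succ m ih =>
    rw [Finset.sum_range_succ, ← ih]
    have hsub1 : Nat.primesLE ⌊x 0⌋₊ ⊆ Nat.primesLE ⌊x m⌋₊ := fun p hp => by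
      rw [Nat.mem_primesLE] at hp ⊢
      exact ⟨hp.1.trans (Nat.floor_le_floor (hx (Nat.zero_le m))), hp.2⟩
    have hsub2 : Nat.primesLE ⌊x m⌋₊ ⊆ Nat.primesLE ⌊x (m + 1)⌋₊ := fun p hp => by
      rw [Nat.mem_primesLE] at hp ⊢
      exact ⟨hp.1.trans (Nat.floor_le_floor (hx (Nat.le_succ m))), hp.2⟩
    rw [primeWindow, primeWindow, primeWindow, ← Finset.sum_union]
    · congr 1
      ext p
      simp only [Finset.mem_sdiff, Finset.mem_union]
      constructor
      · rintro ⟨h1, h0⟩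
        by_cases hm : p ∈ Nat.primesLE ⌊x m⌋₊
        · exact Or.inl ⟨hm, h0⟩
        · exact Or.inr ⟨h1, hm⟩
      · rintro (⟨hm, h0⟩ | ⟨h1, hm⟩)
        · exact ⟨hsub2 hm, h0⟩
        · exact ⟨h1, fun h0 => hm (hsub1 h0)⟩
    · rw [Finset.disjoint_left]
      intro p hp hp'
      rw [Finset.mem_sdiff] at hp hp'
      exact hp'.2 hp.1

/-! ### The prime number theorem, upper bound, real form -/

/-- **PNT upper bound for the primes below a real number**: for every `κ > 0` there is `x₀` with
`#{p < x} ≤ (1 + κ) x/log x` for all real `x ≥ x₀` (from the tree's PNT,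
`Chen.eventually_primeCounting_bounds`, and the monotonicity of `t/log t` on `[e, ∞)`).
[cite: MontgomeryVaughan2007, §8.1 (8.1)] -/
theorem exists_card_primesBelow_ceil_le {κ : ℝ} (hκ : 0 < κ) :
    ∃ x₀ : ℝ, ∀ x : ℝ, x₀ ≤ x →
      (#(Nat.primesBelow ⌈x⌉₊) : ℝ) ≤ (1 + κ) * x / Real.log x := by
  obtain ⟨n₀, hn₀⟩ := eventually_atTop.mp (eventually_primeCounting_bounds hκ)
  refine ⟨max (n₀ + 1 : ℕ) 4, fun x hx => ?_⟩
  have hx3 : 4 ≤ x := le_trans (le_max_right _ _) hx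
  have hxn₀ : ((n₀ + 1 : ℕ) : ℝ) ≤ x := le_trans (le_max_left _ _) hx
  -- `n = ⌈x⌉ - 1`, `primes < x` = `primes ≤ n`
  set n : ℕ := ⌈x⌉₊ - 1 with hn
  have hceil : 1 ≤ ⌈x⌉₊ := Nat.one_le_iff_ne_zero.mpr (Nat.pos_iff_ne_zero.mp (Nat.ceil_pos.mpr (by linarith)))
  have hcard : #(Nat.primesBelow ⌈x⌉₊) = Nat.primeCounting n := by
    rw [Nat.primesBelow_card_eq_primeCounting', hn]
    rcases Nat.exists_eq_succ_of_ne_zero (by omega : ⌈x⌉₊ ≠ 0) with ⟨k, hk⟩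
    rw [hk, Nat.primeCounting, Nat.succ_sub_one]
  have hnx : (n : ℝ) ≤ x := by
    have := (Nat.ceil_lt_add_one (by linarith : (0 : ℝ) ≤ x))
    rw [hn, Nat.cast_sub hceil, Nat.cast_one]; linarith
  have hxn : x ≤ n + 1 := by
    have := Nat.le_ceil x
    rw [hn, Nat.cast_sub hceil, Nat.cast_one]; linarith
  have hn₀n : n₀ ≤ n := by
    have : (n₀ : ℝ) + 1 ≤ n + 1 := by push_cast at hxn₀; linarith
    exact_mod_cast (by linarith : (n₀ : ℝ) ≤ n)
  have hn3 : (4 : ℝ) - 1 ≤ n := by linarith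
  have hPNT := (hn₀ n hn₀n).2
  rw [hcard]
  refine hPNT.trans ?_
  -- `n/log n ≤ x/log x` since `t ↦ log t/t` is antitone on `[e, ∞)` and `e ≤ n ≤ x`? need `n ≥ e`:
  have he : Real.exp 1 ≤ n := by
    have := Real.exp_one_lt_d9; linarith
  have hanti := Real.log_div_self_antitoneOn he (le_trans he hnx) hnx
  -- `log x / x ≤ log n / n`
  have hn0 : (0 : ℝ) < n := by linarith
  have hx0 : 0 < x := by linarith
  have hlogn : 0 < Real.log n := Real.log_pos (by linarith)
  have hlogx : 0 < Real.log x := Real.log_pos (by linarith)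
  have hkey : (n : ℝ) / Real.log n ≤ x / Real.log x := by
    rw [div_le_div_iff₀ hlogn hlogx]
    have h := hanti
    simp only at h
    rw [div_le_div_iff₀ hx0 hn0] at h
    linarith
  calc (1 + κ) * ((n : ℝ) / Real.log n) ≤ (1 + κ) * (x / Real.log x) :=
        mul_le_mul_of_nonneg_left hkey (by linarith)
    _ = (1 + κ) * x / Real.log x := by ring


/-! ### The weighted window tool: sums `∑ w(p)` against the grid `X^{t₀ + jΔ}` -/

/-- **Weighted prime sums along a geometric grid** (Mertens on each window): for `X > 1`,
`t₀ > 0`, `Δ > 0`, `X^{t₀} ≥ 2`, and weights with `w(p) ≤ g_j/p` on the window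
`X^{t_j} < p ≤ X^{t_{j+1}}`, `t_j = t₀ + jΔ`, `g_j ≥ 0`:
`∑_{X^{t₀} < p ≤ X^{t_m}} w(p) ≤ ∑_{j<m} g_j (Δ/t_j + 16/(t_j log X))`. [folklore] -/
theorem sum_primeWindow_grid_le {X : ℝ} (hX : 1 < X) {t₀ Δ : ℝ} (ht₀ : 0 < t₀) (hΔ : 0 < Δ) (m : ℕ)
    (hx2 : 2 ≤ X ^ t₀) (w g : ℕ → ℝ) (hg0 : ∀ j, 0 ≤ g j)
    (hw : ∀ j, j < m → ∀ p ∈ primeWindow (X ^ (t₀ + j * Δ)) (X ^ (t₀ + (j + 1) * Δ)),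
      w p ≤ g j * (p : ℝ)⁻¹) :
    ∑ p ∈ primeWindow (X ^ t₀) (X ^ (t₀ + m * Δ)), w p ≤
      ∑ j ∈ Finset.range m, g j * (Δ / (t₀ + j * Δ) + 16 / ((t₀ + j * Δ) * Real.log X)) := by
  have hX0 : 0 < X := by linarith
  have hlogX : 0 < Real.log X := Real.log_pos hX
  set x : ℕ → ℝ := fun j => X ^ (t₀ + j * Δ) with hx
  have hxmono : Monotone x := by
    intro i j hij
    simp only [hx]
    refine Real.rpow_le_rpow_of_exponent_le hX.le ?_
    have : (i : ℝ) ≤ j := by exact_mod_cast hij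
    nlinarith
  have hx0 : x 0 = X ^ t₀ := by simp [hx]
  have hxm : x m = X ^ (t₀ + m * Δ) := by simp [hx]
  rw [← hx0, ← hxm, sum_primeWindow_eq_sum_range x hxmono w m]
  refine Finset.sum_le_sum fun j hj => ?_
  have hj' : j < m := Finset.mem_range.mp hj
  have htj : 0 < t₀ + j * Δ := by positivity
  -- Mertens on the window `(x j, x (j+1)]`
  have hx2j : 2 ≤ x j := hx2.trans (by rw [← hx0]; exact hxmono (Nat.zero_le j))
  have hxj1 : x j ≤ x (j + 1) := hxmono (Nat.le_succ j)
  have hlogxj : Real.log (x j) = (t₀ + j * Δ) * Real.log X := by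
    simp only [hx]; rw [Real.log_rpow hX0]
  have hlogxj1 : Real.log (x (j + 1)) = (t₀ + (j + 1) * Δ) * Real.log X := by
    simp only [hx]; push_cast; rw [Real.log_rpow hX0]
  have h1 : ∑ p ∈ primeWindow (x j) (x (j + 1)), w p ≤
      ∑ p ∈ primeWindow (x j) (x (j + 1)), g j * (p : ℝ)⁻¹ :=
    Finset.sum_le_sum fun p hp => hw j hj' p (by simpa only [hx, Nat.cast_add, Nat.cast_one] using hp)
  refine h1.trans ?_
  refine (sum_mul_inv_primeWindow_le hx2j hxj1 (fun p _ => le_rfl) (hg0 j)).trans ?_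
  refine mul_le_mul_of_nonneg_left ?_ (hg0 j)
  rw [hlogxj, hlogxj1]
  have hratio : Real.log ((t₀ + (j + 1) * Δ) * Real.log X / ((t₀ + j * Δ) * Real.log X)) ≤
      Δ / (t₀ + j * Δ) := by
    have e : (t₀ + (j + 1) * Δ) * Real.log X / ((t₀ + j * Δ) * Real.log X) =
        1 + Δ / (t₀ + j * Δ) := by
      field_simp
      ring
    rw [e]
    have := Real.log_le_sub_one_of_pos (show 0 < 1 + Δ / (t₀ + j * Δ) by positivity)
    linarith
  have h16 : 16 / ((t₀ + j * Δ) * Real.log X) = 16 / ((t₀ + j * Δ) * Real.log X) := rfl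
  linarith

/-! ### From `T̃(N, ε)` to a sum over `(p₁, p₂)` (Nathanson p. 289) -/

/-- The range of `p₁`: primes with `z ≤ p₁ < y`. [folklore] -/
def firstPrimes (N : ℕ) : Finset ℕ := (Nat.primesBelow ⌈y N⌉₊).filter fun p => z N ≤ (p : ℝ)

/-- The range of `p₂` given `p₁`: primes with `y ≤ p₂` and `p₁p₂² < (1+ε)N`. [folklore] -/
def secondPrimes (N : ℕ) (ε : ℝ) (p₁ : ℕ) : Finset ℕ :=
  (Nat.primesBelow ⌈Real.sqrt ((1 + ε) * N / p₁)⌉₊).filter fun p => y N ≤ (p : ℝ)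

/-- Membership in `firstPrimes`. [folklore] -/
theorem mem_firstPrimes {N p : ℕ} : p ∈ firstPrimes N ↔ p.Prime ∧ z N ≤ (p : ℝ) ∧ (p : ℝ) < y N := by
  rw [firstPrimes, Finset.mem_filter, Nat.mem_primesBelow, Nat.lt_ceil]
  tauto

/-- Membership in `secondPrimes`. [folklore] -/
theorem mem_secondPrimes {N : ℕ} {ε : ℝ} {p₁ p : ℕ} :
    p ∈ secondPrimes N ε p₁ ↔ p.Prime ∧ y N ≤ (p : ℝ) ∧ (p : ℝ) < Real.sqrt ((1 + ε) * N / p₁) := by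
  rw [secondPrimes, Finset.mem_filter, Nat.mem_primesBelow, Nat.lt_ceil]
  tauto

/-- **`|B̃| ≤ ∑_{p₁} ∑_{p₂} π((1+ε)N/(p₁p₂))`** (Nathanson p. 289: a triple of `T̃(N, ε)` has
`p₁p₂p₃ < (1+ε)N`, hence `p₁p₂² < (1+ε)N` and `p₃ < (1+ε)N/(p₁p₂)`).
[cite: Nathanson1996, Thm 10.6 (proof, (10.14) and p. 289)] -/
theorem card_switchedTriplesExt_le_sum {N : ℕ} {ε : ℝ} (hN : 0 < N) (hε : 0 < ε) :
    (#(switchedTriplesExt N ε) : ℝ) ≤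
      ∑ p₁ ∈ firstPrimes N, ∑ p₂ ∈ secondPrimes N ε p₁,
        (#(Nat.primesBelow ⌈(1 + ε) * N / (p₁ * p₂)⌉₊) : ℝ) := by
  classical
  set S : Finset (Σ _ : ℕ, Σ _ : ℕ, ℕ) := (firstPrimes N).sigma fun p₁ =>
    (secondPrimes N ε p₁).sigma fun p₂ => Nat.primesBelow ⌈(1 + ε) * N / (p₁ * p₂)⌉₊ with hS
  have hcardS : (#S : ℝ) = ∑ p₁ ∈ firstPrimes N, ∑ p₂ ∈ secondPrimes N ε p₁,
      (#(Nat.primesBelow ⌈(1 + ε) * N / (p₁ * p₂)⌉₊) : ℝ) := by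
    rw [hS, Finset.card_sigma]
    push_cast
    refine Finset.sum_congr rfl fun p₁ _ => ?_
    rw [Finset.card_sigma]
    push_cast
    rfl
  rw [← hcardS]
  have hN0 : (0 : ℝ) < N := by exact_mod_cast hN
  refine Nat.cast_le.mpr (Finset.card_le_card_of_injOn
    (fun t : ℕ × ℕ × ℕ => (⟨t.1, ⟨t.2.1, t.2.2⟩⟩ : Σ _ : ℕ, Σ _ : ℕ, ℕ)) (fun t ht => ?_) ?_)
  · rw [Finset.mem_coe] at ht
    obtain ⟨-, h₁, h₂, h₃, hz, hy, hy', h23, -, -, hlt⟩ := mem_switchedTriplesExt.mp ht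
    rw [Finset.mem_coe, hS, Finset.mem_sigma, Finset.mem_sigma, mem_firstPrimes, mem_secondPrimes,
      Nat.mem_primesBelow, Nat.lt_ceil]
    dsimp only
    -- `p₁p₂p₃ < (1+ε) N`
    have hℓ := chenGridPoint_pos hN hε t.1
    have hp1 : (t.1 : ℝ) < (1 + ε) * chenGridPoint N ε t.1 := lt_mul_chenGridPoint hN hε hz
    have h2pos : (0 : ℝ) < t.2.1 := by exact_mod_cast h₂.pos
    have h3pos : (0 : ℝ) < t.2.2 := by exact_mod_cast h₃.pos
    have h1pos : (0 : ℝ) < t.1 := by exact_mod_cast h₁.pos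
    have hprod : (t.1 : ℝ) * t.2.1 * t.2.2 < (1 + ε) * N := by
      calc (t.1 : ℝ) * t.2.1 * t.2.2 = (t.1 : ℝ) * ((t.2.1 : ℝ) * t.2.2) := by ring
        _ < (1 + ε) * chenGridPoint N ε t.1 * ((t.2.1 : ℝ) * t.2.2) := by gcongr
        _ = (1 + ε) * (chenGridPoint N ε t.1 * t.2.1 * t.2.2) := by ring
        _ < (1 + ε) * N := by gcongr
    have h23' : (t.2.1 : ℝ) ≤ t.2.2 := by exact_mod_cast h23
    refine ⟨⟨h₁, hz, hy⟩, ⟨h₂, hy', ?_⟩, ?_, h₃⟩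
    · -- `p₂ < √((1+ε)N/p₁)`
      rw [Real.lt_sqrt h2pos.le, lt_div_iff₀ h1pos]
      calc (t.2.1 : ℝ) ^ 2 * t.1 = t.1 * t.2.1 * t.2.1 := by ring
        _ ≤ t.1 * t.2.1 * t.2.2 := by gcongr
        _ < (1 + ε) * N := hprod
    · -- `p₃ < (1+ε)N/(p₁p₂)`
      rw [lt_div_iff₀ (by positivity)]
      linarith [hprod]
  · intro t _ t' _ h
    simp only [Sigma.mk.injEq, heq_eq_eq] at h
    obtain ⟨h1, h2, h3⟩ := h
    exact Prod.ext h1 (Prod.ext h2 h3)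


/-! ### The inner sum over `p₂` (Nathanson pp. 289–290: `∑ h(p₂)/p₂ = H(p₁) + O((log N)⁻²)`) -/

/-- The kernel `h(v) = 1/(v(c − v))` is continuous on `[a, b]` whenever `0 < a` and `b < c`.
[folklore] -/
theorem continuousOn_inv_mul_sub {c a b : ℝ} (ha : 0 < a) (hb : b < c) :
    ContinuousOn (fun v : ℝ => 1 / (v * (c - v))) (Set.Icc a b) := by
  refine continuousOn_const.div (continuousOn_id.mul (continuousOn_const.sub continuousOn_id)) ?_
  intro v hv
  have : 0 < v := by linarith [hv.1]
  have : 0 < c - v := by linarith [hv.2]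
  positivity

set_option maxHeartbeats 800000 in
/-- **The inner sum** (Nathanson pp. 289–290, the estimate `∑_{y ≤ p₂ < (N'/p₁)^{1/2}}
1/(p₂ log(N'/p₁p₂)) = H(p₁) + O((log N)^{−2})`, in upper-bound form with Mertens' theorem in
place of the prime number theorem): for `X > 1`, `2/3 ≤ c < 1`, `1/4 ≤ t₀ ≤ 1/3`, `m ≥ 1` and
`X^{t₀} ≥ 2`,
`∑_{X^{t₀} < p ≤ X^{c/2}} (1/p) · 1/(c − log p/log X) ≤ (1 + 4/m)(Φ(1 − c) + 12(1/3 − t₀)) + 192 m/log X`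
(grid `t_j = t₀ + j(c/2 − t₀)/m`; on each window `1/(c − u) ≤ 1/(c − t_{j+1})`; the Riemann sum of
the antitone `1/(v(c−v))` is below its integral `∫_{t₀}^{c/2} = ∫_{t₀}^{1/3} + Φ(1−c)`).
[cite: Nathanson1996, Thm 10.6 (proof, pp. 289–290)] -/
theorem inner_sum_le {X c t₀ : ℝ} (hX : 1 < X) (hc : 2 / 3 ≤ c) (hc1 : c < 1) (ht₀ : 1 / 4 ≤ t₀)
    (ht₀' : t₀ ≤ 1 / 3) {m : ℕ} (hm : 1 ≤ m) (hx2 : 2 ≤ X ^ t₀) :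
    ∑ p ∈ primeWindow (X ^ t₀) (X ^ (c / 2)), (p : ℝ)⁻¹ * (1 / (c - Real.log p / Real.log X)) ≤
      (1 + 4 / m) * (phiFun (1 - c) + 12 * (1 / 3 - t₀)) + 192 * m / Real.log X := by
  have hX0 : 0 < X := by linarith
  have hL : 0 < Real.log X := Real.log_pos hX
  have hm0 : (0 : ℝ) < m := by exact_mod_cast hm
  have ht₀0 : 0 < t₀ := by linarith
  have hΦ0 : 0 ≤ phiFun (1 - c) := phiFun_nonneg (by linarith)
  have hRHS0 : 0 ≤ (1 + 4 / m) * (phiFun (1 - c) + 12 * (1 / 3 - t₀)) + 192 * m / Real.log X := by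
    have : 0 ≤ 1 / 3 - t₀ := by linarith
    positivity
  -- the degenerate case `c/2 = t₀` (empty window)
  rcases eq_or_lt_of_le (show t₀ ≤ c / 2 by linarith) with heq | hlt
  · rw [← heq]
    have : primeWindow (X ^ t₀) (X ^ t₀) = ∅ := by simp [primeWindow]
    rw [this, Finset.sum_empty]
    exact hRHS0
  -- the grid
  set Δ : ℝ := (c / 2 - t₀) / m with hΔ
  have hΔ0 : 0 < Δ := div_pos (by linarith) hm0
  have hmΔ : t₀ + m * Δ = c / 2 := by rw [hΔ]; field_simp; ring
  have hΔle : Δ ≤ (c / 2 - t₀) := by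
    rw [hΔ, div_le_iff₀ hm0]
    have : (1 : ℝ) ≤ m := by exact_mod_cast hm
    nlinarith
  have hΔ14 : Δ ≤ 1 / 4 := by linarith
  set t : ℕ → ℝ := fun j => t₀ + j * Δ with ht
  have htj_le : ∀ j : ℕ, j ≤ m → t j ≤ c / 2 := fun j hj => by
    simp only [ht]
    have : (j : ℝ) ≤ m := by exact_mod_cast hj
    nlinarith
  -- weights and bounds
  set g : ℕ → ℝ := fun j => 1 / (c - min (t (j + 1)) (c / 2)) with hg
  have hden : ∀ j : ℕ, c / 2 ≤ c - min (t (j + 1)) (c / 2) := fun j => by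
    have := min_le_right (t (j + 1)) (c / 2); linarith
  have hc0 : 0 < c := by linarith
  have hg0 : ∀ j, 0 ≤ g j := fun j => by
    simp only [hg]; exact div_nonneg zero_le_one (by linarith [hden j])
  have hgle : ∀ j, g j ≤ 2 / c := fun j => by
    simp only [hg]
    rw [div_le_div_iff₀ (by linarith [hden j]) hc0]
    linarith [hden j]
  have hg_eq : ∀ j, j < m → g j = 1 / (c - t (j + 1)) := fun j hj => by
    simp only [hg]
    rw [min_eq_left (htj_le (j + 1) (by omega))]
  -- the weight inequality on each window
  have hw : ∀ j, j < m → ∀ p ∈ primeWindow (X ^ (t₀ + j * Δ)) (X ^ (t₀ + (j + 1) * Δ)),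
      (p : ℝ)⁻¹ * (1 / (c - Real.log p / Real.log X)) ≤ g j * (p : ℝ)⁻¹ := by
    intro j hj p hp
    have hx1 : 0 ≤ X ^ (t₀ + j * Δ) := Real.rpow_nonneg hX0.le _
    obtain ⟨hprime, hlo, hhi⟩ := (mem_primeWindow hx1).mp hp
    have hp0 : (0 : ℝ) < p := by exact_mod_cast hprime.pos
    -- `log p / log X ≤ t (j+1)`
    have hu : Real.log p / Real.log X ≤ t (j + 1) := by
      rw [div_le_iff₀ hL]
      have := Real.log_le_log hp0 hhi
      rw [Real.log_rpow hX0] at this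
      simp only [ht]; push_cast; linarith
    have hpos : 0 < c - t (j + 1) := by
      have := htj_le (j + 1) (by omega); linarith
    rw [mul_comm, hg_eq j hj]
    refine mul_le_mul_of_nonneg_right ?_ (by positivity)
    exact one_div_le_one_div_of_le hpos (by linarith)
  have htool := sum_primeWindow_grid_le hX ht₀0 hΔ0 m hx2 _ g hg0 hw
  rw [hmΔ] at htool
  refine htool.trans ?_
  -- bound the grid sum: `g_j Δ/t_j ≤ (1 + Δ/t₀) Δ h(t_{j+1})`, `g_j 16/(t_j L) ≤ 192/L`
  set h : ℝ → ℝ := fun v => 1 / (v * (c - v)) with hh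
  have hterm : ∀ j ∈ Finset.range m,
      g j * (Δ / (t₀ + j * Δ) + 16 / ((t₀ + j * Δ) * Real.log X)) ≤
        (1 + Δ / t₀) * (Δ * h (t₀ + (j + 1) * Δ)) + 192 / Real.log X := by
    intro j hj
    have hj' : j < m := Finset.mem_range.mp hj
    have htjpos : 0 < t₀ + j * Δ := by positivity
    have htj1 : t₀ + (j + 1) * Δ ≤ c / 2 := by
      have := htj_le (j + 1) (by omega); simp only [ht] at this; push_cast at this; exact this
    have hpos : 0 < c - (t₀ + (j + 1) * Δ) := by linarith
    have hgj : g j = 1 / (c - (t₀ + (j + 1) * Δ)) := by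
      rw [hg_eq j hj']; simp only [ht]; push_cast; ring_nf
    -- first piece
    have h1 : g j * (Δ / (t₀ + j * Δ)) ≤ (1 + Δ / t₀) * (Δ * h (t₀ + (j + 1) * Δ)) := by
      rw [hgj]
      simp only [hh]
      have htj1pos : 0 < t₀ + (j + 1) * Δ := by positivity
      -- `1/t_j ≤ (1 + Δ/t₀)/t_{j+1}`
      have hratio : 1 / (t₀ + j * Δ) ≤ (1 + Δ / t₀) / (t₀ + (j + 1) * Δ) := by
        rw [div_le_div_iff₀ htjpos htj1pos]
        have : Δ * (j * Δ) / t₀ ≥ 0 := by positivity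
        calc 1 * (t₀ + (j + 1) * Δ) = (t₀ + j * Δ) + Δ := by ring
          _ ≤ (t₀ + j * Δ) + Δ + Δ * (j * Δ) / t₀ := by linarith
          _ = (1 + Δ / t₀) * (t₀ + j * Δ) := by field_simp; ring
      calc 1 / (c - (t₀ + (j + 1) * Δ)) * (Δ / (t₀ + j * Δ))
          = Δ * (1 / (c - (t₀ + (j + 1) * Δ))) * (1 / (t₀ + j * Δ)) := by ring
        _ ≤ Δ * (1 / (c - (t₀ + (j + 1) * Δ))) * ((1 + Δ / t₀) / (t₀ + (j + 1) * Δ)) :=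
            mul_le_mul_of_nonneg_left hratio (by positivity)
        _ = (1 + Δ / t₀) * (Δ * (1 / ((t₀ + (j + 1) * Δ) * (c - (t₀ + (j + 1) * Δ))))) := by
            field_simp
    -- second piece
    have h2 : g j * (16 / ((t₀ + j * Δ) * Real.log X)) ≤ 192 / Real.log X := by
      have hg3 : g j ≤ 3 := (hgle j).trans (by rw [div_le_iff₀ hc0]; linarith)
      have hinv : 16 / ((t₀ + j * Δ) * Real.log X) ≤ 64 / Real.log X := by
        rw [div_le_div_iff₀ (by positivity) hL]
        have hq : 1 / 4 ≤ t₀ + j * Δ := le_trans ht₀ (le_add_of_nonneg_right (by positivity))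
        have := mul_le_mul_of_nonneg_right hq hL.le
        nlinarith
      calc g j * (16 / ((t₀ + j * Δ) * Real.log X)) ≤ 3 * (64 / Real.log X) :=
            mul_le_mul hg3 hinv (by positivity) (by norm_num)
        _ = 192 / Real.log X := by ring
    rw [mul_add]
    exact add_le_add h1 h2
  refine (Finset.sum_le_sum hterm).trans ?_
  rw [Finset.sum_add_distrib, Finset.sum_const, Finset.card_range, nsmul_eq_mul, ← Finset.mul_sum]
  -- the Riemann sum of the antitone kernel
  have hanti : AntitoneOn h (Set.Icc t₀ (t₀ + m * Δ)) := by
    rw [hmΔ]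
    exact (inv_mul_sub_antitoneOn c).mono fun v hv => ⟨by linarith [hv.1], hv.2⟩
  have hRS := sum_mul_le_integral_of_antitoneOn hΔ0 m hanti
  rw [hmΔ] at hRS
  -- `∫_{t₀}^{c/2} h = ∫_{t₀}^{1/3} h + Φ(1-c)`
  have hint_t : IntervalIntegrable h MeasureTheory.volume t₀ (1 / 3) :=
    ((continuousOn_inv_mul_sub ht₀0 (by linarith : (1 : ℝ) / 3 < c)).mono
      (Set.uIcc_of_le ht₀' ▸ le_rfl : Set.uIcc t₀ (1 / 3) ⊆ Set.Icc t₀ (1 / 3))).intervalIntegrable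
  have hint_c : IntervalIntegrable h MeasureTheory.volume (1 / 3) (c / 2) :=
    ((continuousOn_inv_mul_sub (by norm_num : (0 : ℝ) < 1 / 3) (by linarith : c / 2 < c)).mono
      (Set.uIcc_of_le (by linarith : (1 : ℝ) / 3 ≤ c / 2) ▸ le_rfl :
        Set.uIcc (1 / 3 : ℝ) (c / 2) ⊆ Set.Icc (1 / 3) (c / 2))).intervalIntegrable
  have hsplit : ∫ s in t₀..(c / 2), h s = (∫ s in t₀..(1 / 3 : ℝ), h s) + ∫ s in (1 / 3 : ℝ)..(c / 2), h s :=
    (intervalIntegral.integral_add_adjacent_intervals hint_t hint_c).symm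
  have hΦ : ∫ s in (1 / 3 : ℝ)..(c / 2), h s = phiFun (1 - c) := by
    rw [phiFun_eq_integral (by linarith : 1 - c ≤ 1 / 3)]
    simp only [hh, sub_sub_cancel]
  have hfirst : ∫ s in t₀..(1 / 3 : ℝ), h s ≤ 12 * (1 / 3 - t₀) := by
    have hbound : ∀ s ∈ Set.Icc t₀ (1 / 3), h s ≤ 12 := by
      intro s hs
      simp only [hh]
      rw [div_le_iff₀ (by nlinarith [hs.1, hs.2])]
      nlinarith [hs.1, hs.2]
    calc ∫ s in t₀..(1 / 3 : ℝ), h s ≤ ∫ _ in t₀..(1 / 3 : ℝ), (12 : ℝ) :=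
          intervalIntegral.integral_mono_on ht₀' hint_t (by simp) hbound
      _ = 12 * (1 / 3 - t₀) := by rw [intervalIntegral.integral_const, smul_eq_mul]; ring
  have hint_le : ∫ s in t₀..(c / 2), h s ≤ phiFun (1 - c) + 12 * (1 / 3 - t₀) := by
    rw [hsplit, hΦ]; linarith
  -- numerical constants
  have hΔt₀ : Δ / t₀ ≤ 4 / m := by
    rw [div_le_div_iff₀ ht₀0 hm0]
    have hΔm : Δ * m = c / 2 - t₀ := by rw [hΔ]; field_simp
    rw [hΔm]
    linarith
  have hfac : 1 + Δ / t₀ ≤ 1 + 4 / m := by linarith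
  have hsum0 : 0 ≤ ∑ i ∈ Finset.range m, Δ * h (t₀ + (i + 1) * Δ) :=
    Finset.sum_nonneg fun i hi => by
      have hi' : i < m := Finset.mem_range.mp hi
      have hle : t₀ + (i + 1) * Δ ≤ c / 2 := by
        have : (i : ℝ) + 1 ≤ m := by exact_mod_cast (show i + 1 ≤ m by omega)
        nlinarith [hmΔ, hΔ0]
      have h1 : 0 < t₀ + (i + 1) * Δ := by positivity
      have h2 : 0 < c - (t₀ + (i + 1) * Δ) := by linarith
      have : 0 ≤ h (t₀ + (i + 1) * Δ) := by
        simp only [hh]; exact div_nonneg zero_le_one (mul_pos h1 h2).le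
      exact mul_nonneg hΔ0.le this
  have hpos4 : (0 : ℝ) ≤ 1 + 4 / m := by positivity
  have hA : (1 + Δ / t₀) * ∑ i ∈ Finset.range m, Δ * h (t₀ + (i + 1) * Δ) ≤
      (1 + 4 / m) * (phiFun (1 - c) + 12 * (1 / 3 - t₀)) :=
    mul_le_mul hfac (hRS.trans hint_le) hsum0 hpos4
  calc (1 + Δ / t₀) * ∑ i ∈ Finset.range m, Δ * h (t₀ + (i + 1) * Δ) + (m : ℝ) * (192 / Real.log X)
      ≤ (1 + 4 / m) * (phiFun (1 - c) + 12 * (1 / 3 - t₀)) + m * (192 / Real.log X) :=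
        add_le_add hA le_rfl
    _ = (1 + 4 / m) * (phiFun (1 - c) + 12 * (1 / 3 - t₀)) + 192 * m / Real.log X := by ring


/-! ### The outer sum over `p₁` (Nathanson p. 290: `∑ H(p₁)/p₁ = c/log N + O((log N)⁻²)`) -/

/-- `Φ(s)/s` is the integrand of the switching constant: `Φ(s)/s = log(2 − 3s)/(s(1 − s))`.
[cite: Nathanson1996, Thm 10.6 (proof, definition of c)] -/
theorem phiFun_div_eq (s : ℝ) : phiFun s / s = Real.log (2 - 3 * s) / (s * (1 - s)) := by
  rw [phiFun, div_div, mul_comm (1 - s) s]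

/-- `∫_{1/8}^{1/3} Φ(s)/s ds = c` (the switching constant of `ChenTheorem.lean`).
[cite: Nathanson1996, Thm 10.6 (proof, p. 290)] -/
theorem integral_phiFun_div : ∫ s in (1 / 8 : ℝ)..(1 / 3), phiFun s / s = switchingConstant := by
  rw [switchingConstant]
  exact intervalIntegral.integral_congr fun s _ => phiFun_div_eq s

/-- `Φ` (hence `Φ(s)/s`) is continuous on `[a, b] ⊆ (0, 1/3]`. [folklore] -/
theorem continuousOn_phiFun_div {a b : ℝ} (ha : 0 < a) (hb : b ≤ 1 / 3) :
    ContinuousOn (fun s => phiFun s / s) (Set.Icc a b) := by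
  have h1 : ContinuousOn (fun s : ℝ => Real.log (2 - 3 * s)) (Set.Icc a b) := by
    refine Real.continuousOn_log.comp (by fun_prop) fun s hs => ?_
    simp only [Set.mem_compl_iff, Set.mem_singleton_iff]
    linarith [hs.2]
  refine ContinuousOn.div (ContinuousOn.div h1 (by fun_prop) fun s hs => ?_) continuousOn_id
    fun s hs => ?_
  · linarith [hs.2]
  · exact (ne_of_gt (lt_of_lt_of_le ha hs.1))

/-- `s ↦ Φ(s)/s` is antitone and bounded by `2/a` on `[a, b] ⊆ (0, 1/3]`. [folklore] -/
theorem phiFun_div_antitoneOn {a b : ℝ} (ha : 0 < a) (hb : b ≤ 1 / 3) :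
    AntitoneOn (fun s => phiFun s / s) (Set.Icc a b) := by
  intro u hu v hv huv
  have hu0 : 0 < u := lt_of_lt_of_le ha hu.1
  have hv0 : 0 < v := lt_of_lt_of_le ha hv.1
  have hΦv : 0 ≤ phiFun v := phiFun_nonneg (hv.2.trans hb)
  have hanti := phiFun_antitoneOn ⟨hu0.le, hu.2.trans hb⟩ ⟨hv0.le, hv.2.trans hb⟩ huv
  calc phiFun v / v ≤ phiFun v / u := div_le_div_of_nonneg_left hΦv hu0 huv
    _ ≤ phiFun u / u := div_le_div_of_nonneg_right hanti hu0.le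

set_option maxHeartbeats 800000 in
/-- **The outer sum** (Nathanson p. 290, `∑_{z ≤ p₁ < y} H(p₁)/p₁ = ∫ H d log log + O((log N)⁻²)
= c/log N + O((log N)⁻²)`, in upper-bound form): for `X > 1`, `1/10 ≤ s₀ ≤ 1/8 ≤ s_M ≤ 1/3`,
`m ≥ 1`, `X^{s₀} ≥ 2`,
`∑_{X^{s₀} < p ≤ X^{s_M}} (1/p) Φ(log p/log X) ≤ c + 20(1/8 − s₀) + 20/m + 320 m/log X`
(grid `s_i = s₀ + i(s_M − s₀)/m`; `Φ(u) ≤ Φ(s_i)` on the window by antitonicity; left Riemann sums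
of the antitone `Φ(s)/s` exceed the integral by at most the first term; `∫_{1/8}^{1/3} Φ(s)/s = c`).
[cite: Nathanson1996, Thm 10.6 (proof, p. 290)] -/
theorem outer_sum_le {X s₀ sM : ℝ} (hX : 1 < X) (hs₀ : 1 / 10 ≤ s₀) (hs₀' : s₀ ≤ 1 / 8)
    (hsM : 1 / 8 ≤ sM) (hsM' : sM ≤ 1 / 3) {m : ℕ} (hm : 1 ≤ m) (hx2 : 2 ≤ X ^ s₀) :
    ∑ p ∈ primeWindow (X ^ s₀) (X ^ sM), (p : ℝ)⁻¹ * phiFun (Real.log p / Real.log X) ≤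
      switchingConstant + 20 * (1 / 8 - s₀) + 20 / m + 320 * m / Real.log X := by
  have hX0 : 0 < X := by linarith
  have hL : 0 < Real.log X := Real.log_pos hX
  have hm0 : (0 : ℝ) < m := by exact_mod_cast hm
  have hs₀0 : 0 < s₀ := by linarith
  have hc0 : 0 ≤ switchingConstant := switchingConstant_nonneg
  have hRHS0 : 0 ≤ switchingConstant + 20 * (1 / 8 - s₀) + 20 / m + 320 * m / Real.log X := by
    have : 0 ≤ 1 / 8 - s₀ := by linarith
    positivity
  -- the degenerate case `sM = s₀`
  rcases eq_or_lt_of_le (show s₀ ≤ sM by linarith) with heq | hlt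
  · rw [← heq]
    have : primeWindow (X ^ s₀) (X ^ s₀) = ∅ := by simp [primeWindow]
    rw [this, Finset.sum_empty]
    exact hRHS0
  -- the grid
  set Δ : ℝ := (sM - s₀) / m with hΔ
  have hΔ0 : 0 < Δ := div_pos (by linarith) hm0
  have hmΔ : s₀ + m * Δ = sM := by rw [hΔ]; field_simp; ring
  have hΔm : Δ * m = sM - s₀ := by rw [hΔ]; field_simp
  have hΔle : Δ ≤ 1 / m := by
    rw [hΔ, div_le_div_iff_of_pos_right hm0]; linarith
  have hsi_le : ∀ i : ℕ, i ≤ m → s₀ + i * Δ ≤ sM := fun i hi => by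
    have : (i : ℝ) ≤ m := by exact_mod_cast hi
    nlinarith
  set f : ℝ → ℝ := fun s => phiFun s / s with hf
  set g : ℕ → ℝ := fun i => phiFun (min (s₀ + i * Δ) (1 / 3)) with hg
  have hg0 : ∀ i, 0 ≤ g i := fun i => phiFun_nonneg (min_le_right _ _)
  have hg_eq : ∀ i, i ≤ m → g i = phiFun (s₀ + i * Δ) := fun i hi => by
    simp only [hg]; rw [min_eq_left ((hsi_le i hi).trans hsM')]
  -- the weight inequality on each window
  have hw : ∀ i, i < m → ∀ p ∈ primeWindow (X ^ (s₀ + i * Δ)) (X ^ (s₀ + (i + 1) * Δ)),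
      (p : ℝ)⁻¹ * phiFun (Real.log p / Real.log X) ≤ g i * (p : ℝ)⁻¹ := by
    intro i hi p hp
    have hx1 : 0 ≤ X ^ (s₀ + i * Δ) := Real.rpow_nonneg hX0.le _
    obtain ⟨hprime, hlo, hhi⟩ := (mem_primeWindow hx1).mp hp
    have hp0 : (0 : ℝ) < p := by exact_mod_cast hprime.pos
    have hsi0 : 0 ≤ s₀ + i * Δ := by positivity
    -- `s_i ≤ u_p ≤ s_{i+1} ≤ 1/3`
    have hu_lo : s₀ + i * Δ ≤ Real.log p / Real.log X := by
      rw [le_div_iff₀ hL]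
      have := Real.log_le_log (Real.rpow_pos_of_pos hX0 _) hlo.le
      rw [Real.log_rpow hX0] at this
      linarith
    have hu_hi : Real.log p / Real.log X ≤ 1 / 3 := by
      rw [div_le_iff₀ hL]
      have := Real.log_le_log hp0 hhi
      rw [Real.log_rpow hX0] at this
      have h2 := hsi_le (i + 1) (by omega)
      push_cast at h2
      nlinarith
    rw [mul_comm, hg_eq i hi.le]
    refine mul_le_mul_of_nonneg_right ?_ (by positivity)
    exact phiFun_antitoneOn ⟨hsi0, (hsi_le i hi.le).trans hsM'⟩ ⟨by linarith, hu_hi⟩ hu_lo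
  have htool := sum_primeWindow_grid_le hX hs₀0 hΔ0 m hx2 _ g hg0 hw
  rw [hmΔ] at htool
  refine htool.trans ?_
  -- bound each grid term: `g_i Δ/s_i = Δ f(s_i)`, `g_i 16/(s_i L) ≤ 320/L`
  have hterm : ∀ i ∈ Finset.range m,
      g i * (Δ / (s₀ + i * Δ) + 16 / ((s₀ + i * Δ) * Real.log X)) ≤
        Δ * f (s₀ + i * Δ) + 320 / Real.log X := by
    intro i hi
    have hi' : i < m := Finset.mem_range.mp hi
    have hsipos : 0 < s₀ + i * Δ := by positivity
    have hsi3 : s₀ + i * Δ ≤ 1 / 3 := (hsi_le i hi'.le).trans hsM'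
    rw [hg_eq i hi'.le, mul_add]
    refine add_le_add (le_of_eq ?_) ?_
    · simp only [hf]; field_simp
    · have hΦ2 : phiFun (s₀ + i * Δ) ≤ 2 := phiFun_le_two hsipos.le hsi3
      have hΦ0 : 0 ≤ phiFun (s₀ + i * Δ) := phiFun_nonneg hsi3
      have hinv : 16 / ((s₀ + i * Δ) * Real.log X) ≤ 160 / Real.log X := by
        rw [div_le_div_iff₀ (by positivity) hL]
        have hq : 1 / 10 ≤ s₀ + i * Δ := le_trans hs₀ (le_add_of_nonneg_right (by positivity))
        have := mul_le_mul_of_nonneg_right hq hL.le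
        nlinarith
      calc phiFun (s₀ + i * Δ) * (16 / ((s₀ + i * Δ) * Real.log X)) ≤ 2 * (160 / Real.log X) :=
            mul_le_mul hΦ2 hinv (by positivity) (by norm_num)
        _ = 320 / Real.log X := by ring
  refine (Finset.sum_le_sum hterm).trans ?_
  rw [Finset.sum_add_distrib, Finset.sum_const, Finset.card_range, nsmul_eq_mul]
  -- the left Riemann sum of the antitone `f`
  have hfanti : AntitoneOn f (Set.Icc s₀ sM) := phiFun_div_antitoneOn hs₀0 hsM'
  have hfle : ∀ s ∈ Set.Icc s₀ sM, f s ≤ 20 := fun s hs => by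
    have hs0 : 0 < s := lt_of_lt_of_le hs₀0 hs.1
    simp only [hf]
    rw [div_le_iff₀ hs0]
    have := phiFun_le_two hs0.le (hs.2.trans hsM')
    nlinarith [hs.1]
  have hf0 : ∀ s ∈ Set.Icc s₀ sM, 0 ≤ f s := fun s hs => by
    simp only [hf]
    exact div_nonneg (phiFun_nonneg (hs.2.trans hsM')) (by linarith [hs.1])
  have hfint : IntervalIntegrable f MeasureTheory.volume s₀ sM :=
    ((continuousOn_phiFun_div hs₀0 hsM').mono
      (Set.uIcc_of_le hlt.le ▸ le_rfl : Set.uIcc s₀ sM ⊆ Set.Icc s₀ sM)).intervalIntegrable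
  -- `∑_{i<m} Δ f(s_i) = Δ f(s₀) + ∑_{i<m-1} Δ f(s_{i+1}) ≤ Δ f(s₀) + ∫_{s₀}^{sM} f`
  obtain ⟨m', rfl⟩ : ∃ m', m = m' + 1 := ⟨m - 1, by omega⟩
  have hsum_eq : ∑ i ∈ Finset.range (m' + 1), Δ * f (s₀ + i * Δ) =
      (∑ i ∈ Finset.range m', Δ * f (s₀ + (i + 1) * Δ)) + Δ * f s₀ := by
    rw [Finset.sum_range_succ']
    push_cast
    simp only [zero_mul, add_zero]
  have hRS : ∑ i ∈ Finset.range m', Δ * f (s₀ + (i + 1) * Δ) ≤ ∫ s in s₀..sM, f s := by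
    have hm'Δ : s₀ + m' * Δ ≤ sM := by
      have := hsi_le m' (by omega); exact this
    have hanti' : AntitoneOn f (Set.Icc s₀ (s₀ + m' * Δ)) :=
      hfanti.mono fun s hs => ⟨hs.1, hs.2.trans hm'Δ⟩
    refine (sum_mul_le_integral_of_antitoneOn hΔ0 m' hanti').trans ?_
    refine intervalIntegral.integral_mono_interval le_rfl (by nlinarith) hm'Δ ?_ hfint
    rw [Filter.EventuallyLE, MeasureTheory.ae_restrict_iff' measurableSet_Ioc]
    exact Filter.Eventually.of_forall fun s hs => hf0 s ⟨hs.1.le, hs.2⟩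
  -- `∫_{s₀}^{sM} f ≤ 20 (1/8 - s₀) + c`
  have hint_le : ∫ s in s₀..sM, f s ≤ 20 * (1 / 8 - s₀) + switchingConstant := by
    have hint1 : IntervalIntegrable f MeasureTheory.volume s₀ (1 / 8) :=
      hfint.mono_set (by rw [Set.uIcc_of_le hs₀', Set.uIcc_of_le hlt.le]; exact Set.Icc_subset_Icc le_rfl hsM)
    have hint2 : IntervalIntegrable f MeasureTheory.volume (1 / 8) sM :=
      hfint.mono_set (by rw [Set.uIcc_of_le hsM, Set.uIcc_of_le hlt.le]; exact Set.Icc_subset_Icc hs₀' le_rfl)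
    have hint3 : IntervalIntegrable f MeasureTheory.volume (1 / 8) (1 / 3) :=
      ((continuousOn_phiFun_div (by norm_num : (0 : ℝ) < 1 / 8) le_rfl).mono
        (Set.uIcc_of_le (by norm_num : (1 : ℝ) / 8 ≤ 1 / 3) ▸ le_rfl :
          Set.uIcc (1 / 8 : ℝ) (1 / 3) ⊆ Set.Icc (1 / 8) (1 / 3))).intervalIntegrable
    rw [← intervalIntegral.integral_add_adjacent_intervals hint1 hint2]
    have h1 : ∫ s in s₀..(1 / 8 : ℝ), f s ≤ 20 * (1 / 8 - s₀) := by
      calc ∫ s in s₀..(1 / 8 : ℝ), f s ≤ ∫ _ in s₀..(1 / 8 : ℝ), (20 : ℝ) :=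
            intervalIntegral.integral_mono_on hs₀' hint1 (by simp) fun s hs => hfle s ⟨hs.1, hs.2.trans hsM⟩
        _ = 20 * (1 / 8 - s₀) := by rw [intervalIntegral.integral_const, smul_eq_mul]; ring
    have h2 : ∫ s in (1 / 8 : ℝ)..sM, f s ≤ switchingConstant := by
      rw [← integral_phiFun_div]
      refine intervalIntegral.integral_mono_interval le_rfl hsM hsM' ?_ hint3
      rw [Filter.EventuallyLE, MeasureTheory.ae_restrict_iff' measurableSet_Ioc]
      refine Filter.Eventually.of_forall fun s hs => ?_
      simp only [hf, Pi.zero_apply]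
      exact div_nonneg (phiFun_nonneg hs.2) (by linarith [hs.1])
    linarith
  have hfirst : Δ * f s₀ ≤ 20 / (m' + 1 : ℕ) := by
    have hf20 : f s₀ ≤ 20 := hfle s₀ ⟨le_rfl, hlt.le⟩
    have hf0' : 0 ≤ f s₀ := hf0 s₀ ⟨le_rfl, hlt.le⟩
    calc Δ * f s₀ ≤ (1 / (m' + 1 : ℕ)) * 20 := mul_le_mul hΔle hf20 hf0' (by positivity)
      _ = 20 / (m' + 1 : ℕ) := by ring
  rw [hsum_eq]
  have : ((m' + 1 : ℕ) : ℝ) * (320 / Real.log X) = 320 * ((m' + 1 : ℕ) : ℝ) / Real.log X := by ring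
  rw [this]
  linarith [hRS, hint_le, hfirst]


/-! ### Assembling the count (Nathanson pp. 289–290) -/

/-- **The prime number theorem step** (Nathanson p. 289: `π((1+ε)N/(p₁p₂)) <
(1+2ε)N/(p₁p₂ log(N/p₁p₂))` for `N ≥ N(ε)`): if `#{p < x} ≤ (1+κ)x/log x` for all `x ≥ x₀` and
`N^{1/3} ≥ x₀ ≥ 3`, then with `X' = (1+ε)N`, `L' = log X'`, `u_i = log p_i/L'`,
`#T̃(N, ε) ≤ (1+κ)(X'/L') ∑_{p₁} p₁⁻¹ ∑_{p₂} p₂⁻¹/(1 − u₁ − u₂)`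
(`log(X'/(p₁p₂)) = L'(1 − u₁ − u₂) > 0` as `X'/(p₁p₂) > (X'/p₁)^{1/2} > N^{1/3}`).
[cite: Nathanson1996, Thm 10.6 (proof, p. 289)] -/
theorem card_le_pnt_sum {N : ℕ} {ε κ x₀ : ℝ} (hN : 2 ≤ N) (hε : 0 < ε) (hx₀3 : 3 ≤ x₀)
    (hPNT : ∀ x : ℝ, x₀ ≤ x → (#(Nat.primesBelow ⌈x⌉₊) : ℝ) ≤ (1 + κ) * x / Real.log x)
    (hNx₀ : x₀ ≤ (N : ℝ) ^ (1 / 3 : ℝ)) (hκ : 0 ≤ κ) :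
    (#(switchedTriplesExt N ε) : ℝ) ≤
      (1 + κ) * ((1 + ε) * N / Real.log ((1 + ε) * N)) *
        ∑ p₁ ∈ firstPrimes N, (p₁ : ℝ)⁻¹ * ∑ p₂ ∈ secondPrimes N ε p₁,
          (p₂ : ℝ)⁻¹ * (1 / ((1 - Real.log p₁ / Real.log ((1 + ε) * N)) -
            Real.log p₂ / Real.log ((1 + ε) * N))) := by
  have hNpos : 0 < N := by omega
  have hN0 : (0 : ℝ) < N := by exact_mod_cast hNpos
  have hN1 : (1 : ℝ) < N := by exact_mod_cast (show 1 < N by omega)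
  set X' : ℝ := (1 + ε) * N with hX'
  have hX'N : (N : ℝ) ≤ X' := by rw [hX']; nlinarith
  have hX'0 : 0 < X' := by positivity
  have hX'1 : 1 < X' := by linarith
  set L' : ℝ := Real.log X' with hL'
  have hL'0 : 0 < L' := Real.log_pos hX'1
  refine (card_switchedTriplesExt_le_sum hNpos hε).trans ?_
  rw [Finset.mul_sum]
  refine Finset.sum_le_sum fun p₁ hp₁ => ?_
  rw [Finset.mul_sum, Finset.mul_sum]
  refine Finset.sum_le_sum fun p₂ hp₂ => ?_
  obtain ⟨hp₁prime, hz₁, hy₁⟩ := mem_firstPrimes.mp hp₁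
  obtain ⟨hp₂prime, hy₂, hsq₂⟩ := mem_secondPrimes.mp hp₂
  have hp₁0 : (0 : ℝ) < p₁ := by exact_mod_cast hp₁prime.pos
  have hp₂0 : (0 : ℝ) < p₂ := by exact_mod_cast hp₂prime.pos
  have hy0 : 0 < y N := Real.rpow_pos_of_pos hN0 _
  -- `x = X'/(p₁p₂) ≥ N^{1/3} ≥ x₀`
  set x : ℝ := X' / (p₁ * p₂) with hxdef
  have hx0 : 0 < x := by positivity
  have hxsq : Real.sqrt (X' / p₁) < x := by
    -- `p₁ p₂ < p₁ √(X'/p₁) = √(p₁ X')`, so `x > X'/√(p₁X') = √(X'/p₁)`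
    rw [hxdef, lt_div_iff₀ (by positivity)]
    have h1 : Real.sqrt (X' / p₁) * (p₁ * p₂) < Real.sqrt (X' / p₁) * (p₁ * Real.sqrt (X' / p₁)) := by
      gcongr
    have h2 : Real.sqrt (X' / p₁) * (p₁ * Real.sqrt (X' / p₁)) = X' := by
      have := Real.mul_self_sqrt (show 0 ≤ X' / p₁ by positivity)
      calc Real.sqrt (X' / p₁) * (p₁ * Real.sqrt (X' / p₁)) = p₁ * (Real.sqrt (X' / p₁) * Real.sqrt (X' / p₁)) := by ring
        _ = p₁ * (X' / p₁) := by rw [this]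
        _ = X' := by field_simp
    linarith
  have hxy : y N ≤ Real.sqrt (X' / p₁) := by
    -- `y² = N^{2/3} ≤ N/p₁ ≤ X'/p₁` as `p₁ < y = N^{1/3}`
    rw [Real.le_sqrt' hy0, le_div_iff₀ hp₁0]
    have hy3 : y N ^ 2 * y N = (N : ℝ) := by
      rw [y, ← Real.rpow_natCast, ← Real.rpow_mul hN0.le, ← Real.rpow_add hN0]
      norm_num
    have hyp : y N ^ 2 * (p₁ : ℝ) ≤ y N ^ 2 * y N :=
      mul_le_mul_of_nonneg_left hy₁.le (by positivity)
    calc y N ^ 2 * (p₁ : ℝ) ≤ y N ^ 2 * y N := hyp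
      _ = (N : ℝ) := hy3
      _ ≤ X' := hX'N
  have hxx₀ : x₀ ≤ x := by linarith [hNx₀.trans hxy]
  have hx1 : 1 < x := by linarith
  -- the logarithm
  have hlogx : Real.log x = L' * ((1 - Real.log p₁ / L') - Real.log p₂ / L') := by
    rw [hxdef, Real.log_div hX'0.ne' (by positivity), Real.log_mul hp₁0.ne' hp₂0.ne']
    field_simp
    ring
  have hlogx0 : 0 < Real.log x := Real.log_pos hx1
  have hden : 0 < (1 - Real.log p₁ / L') - Real.log p₂ / L' := by
    have := hlogx0; rw [hlogx] at this
    exact pos_of_mul_pos_right this hL'0.le |> fun h => by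
      rcases lt_trichotomy ((1 - Real.log p₁ / L') - Real.log p₂ / L') 0 with h' | h' | h'
      · nlinarith
      · rw [h', mul_zero] at this; exact absurd this (lt_irrefl 0)
      · exact h'
  -- PNT
  have hpnt := hPNT x hxx₀
  refine hpnt.trans (le_of_eq ?_)
  rw [hlogx, hxdef]
  field_simp


/-- Basic facts for `X' = (1+ε)N`, `0 < ε ≤ 1`, `N ≥ 2`: `1 < X'`, `log N ≤ log X' ≤ log N + 1`.
[folklore] -/
theorem log_enlarged_bounds {N : ℕ} {ε : ℝ} (hN : 2 ≤ N) (hε : 0 < ε) (hε1 : ε ≤ 1) :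
    1 < (1 + ε) * N ∧ Real.log N ≤ Real.log ((1 + ε) * N) ∧
      Real.log ((1 + ε) * N) ≤ Real.log N + 1 := by
  have hN0 : (0 : ℝ) < N := by exact_mod_cast (show 0 < N by omega)
  have hN1 : (1 : ℝ) < N := by exact_mod_cast (show 1 < N by omega)
  refine ⟨by nlinarith, Real.log_le_log hN0 (by nlinarith), ?_⟩
  rw [Real.log_mul (by linarith) hN0.ne']
  have h1 : Real.log (1 + ε) ≤ Real.log 2 := Real.log_le_log (by linarith) (by linarith)
  have h2 := Real.log_two_lt_d9
  linarith

set_option maxHeartbeats 800000 in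
/-- **The inner sum for `p₁ ∈ [z, y)`**: for `N ≥ 6⁸`, `log N ≥ 15`, `0 < ε ≤ 1`, `m ≥ 1`, with
`X' = (1+ε)N`, `L' = log X'`, `u₁ = log p₁/L'`,
`∑_{p₂} p₂⁻¹/(1 − u₁ − u₂) ≤ Φ(u₁) + 8/m + 272 m/L'` (the sum over `y ≤ p₂ < (X'/p₁)^{1/2}`
sits inside the window `(y/e, X'^{(1−u₁)/2}]`, to which `inner_sum_le` applies with
`t₀ = (log y − 1)/L' ∈ [1/4, 1/3]`). [cite: Nathanson1996, Thm 10.6 (proof, pp. 289–290)] -/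
theorem inner_applied {N : ℕ} {ε : ℝ} (hN : 6 ^ 8 ≤ N) (hε : 0 < ε) (hε1 : ε ≤ 1)
    (hL : 15 ≤ Real.log N) {m : ℕ} (hm : 1 ≤ m) {p₁ : ℕ} (hp₁ : p₁ ∈ firstPrimes N) :
    ∑ p₂ ∈ secondPrimes N ε p₁, (p₂ : ℝ)⁻¹ *
        (1 / ((1 - Real.log p₁ / Real.log ((1 + ε) * N)) - Real.log p₂ / Real.log ((1 + ε) * N))) ≤
      phiFun (Real.log p₁ / Real.log ((1 + ε) * N)) + 8 / m + 272 * m / Real.log ((1 + ε) * N) := by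
  have hN2 : 2 ≤ N := le_trans (by norm_num) hN
  have hN0 : (0 : ℝ) < N := by exact_mod_cast (show 0 < N by omega)
  have hN1 : (1 : ℝ) < N := by exact_mod_cast (show 1 < N by omega)
  obtain ⟨hX'1, hLL', hL'L⟩ := log_enlarged_bounds hN2 hε hε1
  set X' : ℝ := (1 + ε) * N with hX'
  set L' : ℝ := Real.log X' with hL'def
  set L : ℝ := Real.log N with hLdef
  have hX'0 : 0 < X' := by linarith
  have hL'0 : 0 < L' := by linarith
  have hm0 : (0 : ℝ) < m := by exact_mod_cast hm
  obtain ⟨hp₁prime, hz₁, hy₁⟩ := mem_firstPrimes.mp hp₁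
  have hp₁0 : (0 : ℝ) < p₁ := by exact_mod_cast hp₁prime.pos
  have hz6 : (6 : ℝ) ≤ z N := by
    rw [z, show (6 : ℝ) = ((6 : ℝ) ^ (8 : ℕ)) ^ (1 / 8 : ℝ) by
      rw [← Real.rpow_natCast, ← Real.rpow_mul (by norm_num)]; norm_num]
    exact Real.rpow_le_rpow (by norm_num) (by exact_mod_cast hN) (by norm_num)
  have hlogz : Real.log (z N) = L / 8 := by rw [z, Real.log_rpow hN0]; ring
  have hlogy : Real.log (y N) = L / 3 := by rw [y, Real.log_rpow hN0]; ring
  have hy0 : 0 < y N := Real.rpow_pos_of_pos hN0 _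
  -- `u₁ ∈ (0, 1/3)`
  set u₁ : ℝ := Real.log p₁ / L' with hu₁
  have hlogp₁ : 0 < Real.log p₁ := Real.log_pos (by linarith)
  have hlogp₁y : Real.log p₁ < L / 3 := by rw [← hlogy]; exact Real.log_lt_log hp₁0 hy₁
  have hu₁0 : 0 < u₁ := div_pos hlogp₁ hL'0
  have hu₁3 : u₁ < 1 / 3 := by
    rw [hu₁, div_lt_iff₀ hL'0]; linarith
  set c : ℝ := 1 - u₁ with hc
  have hc23 : 2 / 3 ≤ c := by linarith
  have hc1 : c < 1 := by linarith
  set t₀ : ℝ := (Real.log (y N) - 1) / L' with ht₀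
  have ht₀3 : t₀ ≤ 1 / 3 := by rw [ht₀, div_le_iff₀ hL'0, hlogy]; linarith
  have ht₀4 : 1 / 4 ≤ t₀ := by rw [ht₀, le_div_iff₀ hL'0, hlogy]; linarith
  -- the window endpoints
  have hrpow : ∀ s : ℝ, X' ^ s = Real.exp (L' * s) := fun s => by
    rw [Real.rpow_def_of_pos hX'0]
  have hwin0 : X' ^ t₀ = y N / Real.exp 1 := by
    rw [hrpow, ht₀, mul_div_cancel₀ _ hL'0.ne', Real.exp_sub, Real.exp_log hy0]
  have hwin1 : X' ^ (c / 2) = Real.sqrt (X' / p₁) := by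
    rw [hrpow, Real.sqrt_eq_rpow, Real.rpow_def_of_pos (by positivity), Real.log_div hX'0.ne' hp₁0.ne',
      hc, hu₁]
    congr 1
    field_simp
    ring
  have hx2 : 2 ≤ X' ^ t₀ := by
    rw [hwin0, le_div_iff₀ (Real.exp_pos 1)]
    have he := Real.exp_one_lt_d9
    have : z N ≤ y N := Real.rpow_le_rpow_of_exponent_le hN1.le (by norm_num)
    nlinarith
  -- the sum over `secondPrimes` is a sub-sum over the window
  have hsub : secondPrimes N ε p₁ ⊆ primeWindow (X' ^ t₀) (X' ^ (c / 2)) := by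
    intro p hp
    obtain ⟨hpprime, hyp, hsqp⟩ := mem_secondPrimes.mp hp
    rw [mem_primeWindow (Real.rpow_nonneg hX'0.le _), hwin0, hwin1]
    refine ⟨hpprime, ?_, hsqp.le⟩
    have he : 1 < Real.exp 1 := by have := Real.exp_one_gt_d9; linarith
    have : y N / Real.exp 1 < y N := div_lt_self hy0 he
    linarith
  have hnonneg : ∀ p ∈ primeWindow (X' ^ t₀) (X' ^ (c / 2)),
      0 ≤ (p : ℝ)⁻¹ * (1 / (c - Real.log p / L')) := by
    intro p hp
    obtain ⟨hpprime, -, hhi⟩ := (mem_primeWindow (Real.rpow_nonneg hX'0.le _)).mp hp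
    have hp0 : (0 : ℝ) < p := by exact_mod_cast hpprime.pos
    have hu : Real.log p / L' ≤ c / 2 := by
      rw [div_le_iff₀ hL'0]
      have := Real.log_le_log hp0 hhi
      rw [Real.log_rpow hX'0] at this
      linarith
    have : 0 < c - Real.log p / L' := by linarith
    positivity
  have hstep : ∑ p₂ ∈ secondPrimes N ε p₁, (p₂ : ℝ)⁻¹ * (1 / (c - Real.log p₂ / L')) ≤
      ∑ p₂ ∈ primeWindow (X' ^ t₀) (X' ^ (c / 2)), (p₂ : ℝ)⁻¹ * (1 / (c - Real.log p₂ / L')) :=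
    Finset.sum_le_sum_of_subset_of_nonneg hsub fun p hp _ => hnonneg p hp
  refine hstep.trans ?_
  refine (inner_sum_le hX'1 hc23 hc1 ht₀4 ht₀3 hm hx2).trans ?_
  -- numerical cleanup
  have hΦ : phiFun (1 - c) = phiFun u₁ := by rw [hc, sub_sub_cancel]
  rw [hΦ]
  have hΦ2 : phiFun u₁ ≤ 2 := phiFun_le_two hu₁0.le hu₁3.le
  have hΦ0 : 0 ≤ phiFun u₁ := phiFun_nonneg hu₁3.le
  have ht₀' : 12 * (1 / 3 - t₀) ≤ 16 / L' := by
    rw [ht₀, hlogy]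
    rw [show (1 : ℝ) / 3 - (L / 3 - 1) / L' = (L' / 3 - (L / 3 - 1)) / L' by field_simp]
    rw [mul_div_assoc', div_le_div_iff_of_pos_right hL'0]
    linarith
  have hm1 : (1 : ℝ) ≤ m := by exact_mod_cast hm
  have e1 : (1 + 4 / (m : ℝ)) * (phiFun u₁ + 12 * (1 / 3 - t₀)) ≤
      phiFun u₁ + 8 / m + 80 / L' := by
    have h4m : 0 ≤ 4 / (m : ℝ) := by positivity
    have h4m1 : 4 / (m : ℝ) ≤ 4 := by rw [div_le_iff₀ hm0]; linarith
    have h12 : 0 ≤ 12 * (1 / 3 - t₀) := by linarith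
    calc (1 + 4 / (m : ℝ)) * (phiFun u₁ + 12 * (1 / 3 - t₀))
        = phiFun u₁ + 4 / m * phiFun u₁ + (1 + 4 / m) * (12 * (1 / 3 - t₀)) := by ring
      _ ≤ phiFun u₁ + 4 / m * 2 + (1 + 4) * (16 / L') := by
          gcongr
      _ = phiFun u₁ + 8 / m + 80 / L' := by ring
  have e2 : 80 / L' + 192 * m / L' ≤ 272 * m / L' := by
    rw [← add_div, div_le_div_iff_of_pos_right hL'0]; linarith
  linarith

set_option maxHeartbeats 800000 in
/-- **The outer sum over `p₁ ∈ [z, y)`**: for `N ≥ 6⁸`, `log N ≥ 136`, `0 < ε ≤ 1`, `m ≥ 1`, `ρ ≥ 0`,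
`∑_{z ≤ p₁ < y} p₁⁻¹ (Φ(u₁) + ρ) ≤ c + 40/L' + 20/m + 320 m/L' + 3ρ` (the range sits inside the window
`(z/e, y] = (X'^{s₀}, X'^{s_M}]` with `s₀ = (log z − 1)/L' ∈ [1/10, 1/8]`, `s_M = log y/L' ∈
[1/8, 1/3]`; `outer_sum_le`, and `∑_{z/e < p ≤ y} 1/p ≤ 3` by Mertens).
[cite: Nathanson1996, Thm 10.6 (proof, p. 290)] -/
theorem outer_applied {N : ℕ} {ε : ℝ} (hN : 6 ^ 8 ≤ N) (hε : 0 < ε) (hε1 : ε ≤ 1)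
    (hL : 136 ≤ Real.log N) {m : ℕ} (hm : 1 ≤ m) {ρ : ℝ} (hρ : 0 ≤ ρ) :
    ∑ p₁ ∈ firstPrimes N, (p₁ : ℝ)⁻¹ * (phiFun (Real.log p₁ / Real.log ((1 + ε) * N)) + ρ) ≤
      switchingConstant + 40 / Real.log ((1 + ε) * N) + 20 / m +
        320 * m / Real.log ((1 + ε) * N) + 3 * ρ := by
  have hN2 : 2 ≤ N := le_trans (by norm_num) hN
  have hN0 : (0 : ℝ) < N := by exact_mod_cast (show 0 < N by omega)
  have hN1 : (1 : ℝ) < N := by exact_mod_cast (show 1 < N by omega)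
  obtain ⟨hX'1, hLL', hL'L⟩ := log_enlarged_bounds hN2 hε hε1
  set X' : ℝ := (1 + ε) * N with hX'
  set L' : ℝ := Real.log X' with hL'def
  set L : ℝ := Real.log N with hLdef
  have hX'0 : 0 < X' := by linarith
  have hL'0 : 0 < L' := by linarith
  have hm0 : (0 : ℝ) < m := by exact_mod_cast hm
  have hz6 : (6 : ℝ) ≤ z N := by
    rw [z, show (6 : ℝ) = ((6 : ℝ) ^ (8 : ℕ)) ^ (1 / 8 : ℝ) by
      rw [← Real.rpow_natCast, ← Real.rpow_mul (by norm_num)]; norm_num]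
    exact Real.rpow_le_rpow (by norm_num) (by exact_mod_cast hN) (by norm_num)
  have hz0 : 0 < z N := by linarith
  have hlogz : Real.log (z N) = L / 8 := by rw [z, Real.log_rpow hN0]; ring
  have hlogy : Real.log (y N) = L / 3 := by rw [y, Real.log_rpow hN0]; ring
  have hy0 : 0 < y N := Real.rpow_pos_of_pos hN0 _
  have hzy : z N ≤ y N := Real.rpow_le_rpow_of_exponent_le hN1.le (by norm_num)
  -- the exponents
  set s₀ : ℝ := (Real.log (z N) - 1) / L' with hs₀
  set sM : ℝ := Real.log (y N) / L' with hsM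
  have hs₀8 : s₀ ≤ 1 / 8 := by rw [hs₀, div_le_iff₀ hL'0, hlogz]; linarith
  have hs₀10 : 1 / 10 ≤ s₀ := by rw [hs₀, le_div_iff₀ hL'0, hlogz]; linarith
  have hsM3 : sM ≤ 1 / 3 := by rw [hsM, div_le_iff₀ hL'0, hlogy]; linarith
  have hsM8 : 1 / 8 ≤ sM := by rw [hsM, le_div_iff₀ hL'0, hlogy]; linarith
  have hrpow : ∀ s : ℝ, X' ^ s = Real.exp (L' * s) := fun s => by rw [Real.rpow_def_of_pos hX'0]
  have hwin0 : X' ^ s₀ = z N / Real.exp 1 := by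
    rw [hrpow, hs₀, mul_div_cancel₀ _ hL'0.ne', Real.exp_sub, Real.exp_log hz0]
  have hwin1 : X' ^ sM = y N := by
    rw [hrpow, hsM, mul_div_cancel₀ _ hL'0.ne', Real.exp_log hy0]
  have he1 : 1 < Real.exp 1 := by have := Real.exp_one_gt_d9; linarith
  have he3 : Real.exp 1 < 3 := by have := Real.exp_one_lt_d9; linarith
  have hx2 : 2 ≤ X' ^ s₀ := by
    rw [hwin0, le_div_iff₀ (Real.exp_pos 1)]; nlinarith
  -- `firstPrimes ⊆ (z/e, y]`
  have hsub : firstPrimes N ⊆ primeWindow (X' ^ s₀) (X' ^ sM) := by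
    intro p hp
    obtain ⟨hpprime, hzp, hyp⟩ := mem_firstPrimes.mp hp
    rw [mem_primeWindow (Real.rpow_nonneg hX'0.le _), hwin0, hwin1]
    refine ⟨hpprime, ?_, hyp.le⟩
    have : z N / Real.exp 1 < z N := div_lt_self hz0 he1
    linarith
  -- nonnegativity of the summands on the window
  have hu_le : ∀ p ∈ primeWindow (X' ^ s₀) (X' ^ sM), Real.log p / L' ≤ 1 / 3 ∧ 0 ≤ Real.log p / L' := by
    intro p hp
    obtain ⟨hpprime, hlo, hhi⟩ := (mem_primeWindow (Real.rpow_nonneg hX'0.le _)).mp hp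
    have hp0 : (0 : ℝ) < p := by exact_mod_cast hpprime.pos
    have hp1 : (1 : ℝ) ≤ p := by exact_mod_cast hpprime.one_lt.le
    constructor
    · rw [div_le_iff₀ hL'0]
      have := Real.log_le_log hp0 hhi
      rw [Real.log_rpow hX'0] at this
      nlinarith
    · exact div_nonneg (Real.log_nonneg hp1) hL'0.le
  -- split the sum
  have hsplit : ∑ p₁ ∈ firstPrimes N, (p₁ : ℝ)⁻¹ * (phiFun (Real.log p₁ / L') + ρ) ≤
      ∑ p₁ ∈ primeWindow (X' ^ s₀) (X' ^ sM), (p₁ : ℝ)⁻¹ * phiFun (Real.log p₁ / L') +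
        ρ * ∑ p₁ ∈ primeWindow (X' ^ s₀) (X' ^ sM), (p₁ : ℝ)⁻¹ := by
    rw [Finset.mul_sum, ← Finset.sum_add_distrib]
    refine Finset.sum_le_sum_of_subset_of_nonneg hsub ?_ |>.trans (le_of_eq ?_)
    · intro p hp _
      have := (hu_le p hp)
      exact mul_nonneg (by positivity) (add_nonneg (phiFun_nonneg this.1) hρ)
    · exact Finset.sum_congr rfl fun p _ => by ring
  refine hsplit.trans ?_
  have houter := outer_sum_le hX'1 hs₀10 hs₀8 hsM8 hsM3 hm hx2
  -- `∑_{z/e < p ≤ y} 1/p ≤ 3`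
  have hmert : ∑ p₁ ∈ primeWindow (X' ^ s₀) (X' ^ sM), (p₁ : ℝ)⁻¹ ≤ 3 := by
    rw [hwin0, hwin1]
    have hze : 2 ≤ z N / Real.exp 1 := by rw [le_div_iff₀ (Real.exp_pos 1)]; nlinarith
    have hzey : z N / Real.exp 1 ≤ y N := (div_lt_self hz0 he1).le.trans hzy
    refine (sum_inv_primeWindow_le hze hzey).trans ?_
    have hlogze : Real.log (z N / Real.exp 1) = L / 8 - 1 := by
      rw [Real.log_div hz0.ne' (Real.exp_pos 1).ne', Real.log_exp, hlogz]
    rw [hlogze, hlogy]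
    have hden : 0 < L / 8 - 1 := by linarith
    have hratio : L / 3 / (L / 8 - 1) ≤ 3 := by rw [div_le_iff₀ hden]; linarith
    have hlog3 : Real.log (L / 3 / (L / 8 - 1)) ≤ 2 := by
      have h1 : Real.log (L / 3 / (L / 8 - 1)) ≤ Real.log 3 :=
        Real.log_le_log (by positivity) hratio
      have h2 : Real.log 3 ≤ 3 - 1 := Real.log_le_sub_one_of_pos (by norm_num)
      linarith
    have h16 : 16 / (L / 8 - 1) ≤ 1 := by rw [div_le_iff₀ hden]; linarith
    linarith
  have hs₀' : 20 * (1 / 8 - s₀) ≤ 40 / L' := by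
    rw [hs₀, hlogz, show (1 : ℝ) / 8 - (L / 8 - 1) / L' = (L' / 8 - (L / 8 - 1)) / L' by field_simp,
      mul_div_assoc', div_le_div_iff_of_pos_right hL'0]
    linarith
  have := mul_le_mul_of_nonneg_left hmert hρ
  linarith


set_option maxHeartbeats 800000 in
/-- **The cardinality of `B̃`** (Nathanson p. 290: `|B̃| < (1 + O(ε)) cN/log N + O(N/(log N)²)`,
`c = ∫_{1/8}^{1/3} log(2−3β)/(β(1−β)) dβ`): for `0 < ε ≤ 1` and every `η > 0`, for all large `N`,
`#T̃(N, ε) ≤ (1+ε)² (c + η) N/log N`.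
The prime number theorem (upper bound, `exists_card_primesBelow_ceil_le`) counts `p₃`; the sums over
`p₂` and `p₁` are compared with the integrals through Mertens' theorem on the windows of a grid in
logarithmic scale (`inner_applied`, `outer_applied`), and the double integral is `c`
(`integral_phiFun_div`). [cite: Nathanson1996, Thm 10.6 (proof, pp. 289–290)] -/
theorem card_switchedTriplesExt_le {ε : ℝ} (hε : 0 < ε) (hε1 : ε ≤ 1) {η : ℝ} (hη : 0 < η) :
    ∀ᶠ N : ℕ in atTop,
      (#(switchedTriplesExt N ε) : ℝ) ≤ (1 + ε) ^ 2 * (switchingConstant + η) * N / Real.log N := by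
  obtain ⟨x₀, hx₀⟩ := exists_card_primesBelow_ceil_le hε
  set x₁ : ℝ := max x₀ 3 with hx₁
  have hx₁3 : 3 ≤ x₁ := le_max_right _ _
  have hPNT : ∀ x : ℝ, x₁ ≤ x → (#(Nat.primesBelow ⌈x⌉₊) : ℝ) ≤ (1 + ε) * x / Real.log x :=
    fun x hx => hx₀ x (le_trans (le_max_left _ _) hx)
  -- the mesh
  set m : ℕ := ⌈176 / η⌉₊ + 1 with hmdef
  have hm1 : 1 ≤ m := by omega
  have hm0 : (0 : ℝ) < m := by exact_mod_cast hm1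
  have hmη : 44 / (m : ℝ) ≤ η / 4 := by
    have h1 : 176 / η ≤ m := by
      rw [hmdef]; push_cast
      exact (Nat.le_ceil _).trans (by linarith)
    rw [div_le_iff₀ hm0]
    rw [div_le_iff₀ hη] at h1
    linarith
  -- eventual conditions
  have hlog : Tendsto (fun N : ℕ => Real.log N) atTop atTop :=
    Real.tendsto_log_atTop.comp (tendsto_natCast_atTop_atTop (R := ℝ))
  have hcube : Tendsto (fun N : ℕ => ((N : ℝ)) ^ (1 / 3 : ℝ)) atTop atTop :=
    (tendsto_rpow_atTop (by norm_num : (0 : ℝ) < 1 / 3)).comp (tendsto_natCast_atTop_atTop (R := ℝ))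
  filter_upwards [eventually_ge_atTop (6 ^ 8), hlog.eventually_ge_atTop 136,
    hlog.eventually_ge_atTop (4 * 1176 * m / η), hcube.eventually_ge_atTop x₁] with N hN hL136 hLm hNx₁
  have hN2 : 2 ≤ N := le_trans (by norm_num) hN
  have hN0 : (0 : ℝ) < N := by exact_mod_cast (show 0 < N by omega)
  obtain ⟨hX'1, hLL', hL'L⟩ := log_enlarged_bounds hN2 hε hε1
  set X' : ℝ := (1 + ε) * N with hX'
  set L' : ℝ := Real.log X' with hL'def
  set L : ℝ := Real.log N with hLdef
  have hL0 : 0 < L := by linarith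
  have hL'0 : 0 < L' := by linarith
  have hL15 : 15 ≤ L := by linarith
  -- Step 1: PNT
  have h1 := card_le_pnt_sum hN2 hε hx₁3 hPNT hNx₁ hε.le
  rw [← hX', ← hL'def] at h1
  -- Step 2: the inner sums
  set ρ : ℝ := 8 / m + 272 * m / L' with hρ
  have hρ0 : 0 ≤ ρ := by positivity
  have h2 : ∑ p₁ ∈ firstPrimes N, (p₁ : ℝ)⁻¹ * ∑ p₂ ∈ secondPrimes N ε p₁,
      (p₂ : ℝ)⁻¹ * (1 / ((1 - Real.log p₁ / L') - Real.log p₂ / L')) ≤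
      ∑ p₁ ∈ firstPrimes N, (p₁ : ℝ)⁻¹ * (phiFun (Real.log p₁ / L') + ρ) := by
    refine Finset.sum_le_sum fun p₁ hp₁ => mul_le_mul_of_nonneg_left ?_ (by positivity)
    have := inner_applied hN hε hε1 hL15 hm1 hp₁
    rw [hρ]; linarith
  -- Step 3: the outer sum
  have h3 := outer_applied hN hε hε1 hL136 hm1 hρ0
  -- assemble
  have hfac0 : 0 ≤ (1 + ε) * (X' / L') := by positivity
  have hB : switchingConstant + 40 / L' + 20 / m + 320 * m / L' + 3 * ρ ≤
      switchingConstant + η / 2 := by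
    have hm1' : (1 : ℝ) ≤ m := by exact_mod_cast hm1
    -- `44/m ≤ η/4` and `1176 m/L' ≤ η/4`
    have hLm' : 4 * 1176 * m / η ≤ L' := hLm.trans hLL'
    have hsecond : 1176 * m / L' ≤ η / 4 := by
      rw [div_le_iff₀ hL'0]
      rw [div_le_iff₀ hη] at hLm'
      nlinarith
    have e1 : 40 / L' + 320 * m / L' + 3 * (272 * m / L') ≤ 1176 * m / L' := by
      rw [show 40 / L' + 320 * m / L' + 3 * (272 * m / L') = (40 + 1136 * m) / L' by ring]
      exact div_le_div_of_nonneg_right (by linarith) hL'0.le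
    have e2 : 20 / (m : ℝ) + 3 * (8 / m) = 44 / m := by ring
    rw [hρ]
    nlinarith [e1, e2, hmη, hsecond]
  have hXL : X' / L' ≤ (1 + ε) * N / L := by
    rw [div_le_div_iff₀ hL'0 hL0, hX']
    have : 0 ≤ (1 + ε) * (N : ℝ) := by positivity
    nlinarith
  calc (#(switchedTriplesExt N ε) : ℝ)
      ≤ (1 + ε) * (X' / L') * ∑ p₁ ∈ firstPrimes N, (p₁ : ℝ)⁻¹ * ∑ p₂ ∈ secondPrimes N ε p₁,
          (p₂ : ℝ)⁻¹ * (1 / ((1 - Real.log p₁ / L') - Real.log p₂ / L')) := h1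
    _ ≤ (1 + ε) * (X' / L') * ∑ p₁ ∈ firstPrimes N, (p₁ : ℝ)⁻¹ * (phiFun (Real.log p₁ / L') + ρ) :=
        mul_le_mul_of_nonneg_left h2 hfac0
    _ ≤ (1 + ε) * (X' / L') * (switchingConstant + η / 2) :=
        mul_le_mul_of_nonneg_left (h3.trans hB) hfac0
    _ ≤ (1 + ε) * ((1 + ε) * N / L) * (switchingConstant + η / 2) := by
        have hc0 : 0 ≤ switchingConstant + η / 2 := by
          have := switchingConstant_nonneg; positivity
        exact mul_le_mul_of_nonneg_right (mul_le_mul_of_nonneg_left hXL (by linarith)) hc0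
    _ ≤ (1 + ε) ^ 2 * (switchingConstant + η) * N / L := by
        rw [show (1 + ε) * ((1 + ε) * N / L) * (switchingConstant + η / 2) =
          ((1 + ε) ^ 2 * (switchingConstant + η / 2) * N) / L by ring]
        refine div_le_div_of_nonneg_right ?_ hL0.le
        have : 0 ≤ (1 + ε) ^ 2 * (N : ℝ) := by positivity
        nlinarith [switchingConstant_nonneg]

end Literature.NumberTheory.Sieve.Chen
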